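import Literature.NumberTheory.Automorphic.BrandtGrossPoints
import Literature.NumberTheory.Automorphic.BrandtXi
import Literature.NumberTheory.EllipticCurves.HeegnerPoints
import Literature.NumberTheory.EllipticCurves.GlobalMinimalModel
import Literature.NumberTheory.EllipticCurves.Selmer
import Literature.NumberTheory.EllipticCurves.Sha
import Literature.NumberTheory.EllipticCurves.MordellWeil
import Literature.NumberTheory.EllipticCurves.BSDQuotientOverNumberField
import Literature.NumberTheory.EllipticCurves.ModularCurve
import Literature.NumberTheory.EllipticCurves.Tamagawa
import Literature.NumberTheory.DiophantineGeometry.TateAlgorithm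
import Summits.BirchSwinnertonDyer.Rank1Residual.Supersingular.SignedLambdaParityTwoMazurTate

/-!
# AN-48 — THE ♯/♭ EDGE AT THE RAMIFIED PRIME 2: `L♯_edge, L♭_edge ∈ ℤ₂⟦T⟧` FOR `a₂ ∈ {0, ±2}` AND THEIR LEADING TERMS
(planner sketch, seat bsd-f1-sign2-an g33, MEMO-an §36; census `Cruxes/RankOneAtTwoBigImageOddLocal/census37.md`)

**v6 (-an g35, 2026-08-30, MEMO-an §39 DUTY 0).**  `EdgeFEOddExponent` (v5) is REFUTED AS TYPED (referee desk 1 §357–§358; independent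
replay `fe39chk.py` on the g28 T58 archive): it lacks the supersingularity binder `2 ∣ a₂`, and on the 28 `a₂`-ODD archive curves of prime conductor
`N ≡ 7 (8)` the level functional equations `ιθ_n = w·X^{s_n}·θ_n` have `s_n` EVEN (172/172 level rows); the law on ALL 832 single-parity level rows
of the 127 archive curves is `(−1)^{s_n} = χ₈(N)` (832/832).  The decl is KEPT VERBATIM below as a settled negative edge (never re-worded in place) and
three statements are ADDED: `EdgeFEExponentChi8` (the χ₈-law for every `a₂`: `c` odd ↔ `N ≡ 3 (8)`, referee desk 1's C′₂), `PrimeConductorEvenTraceModEight` (prime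
conductor + `2 ∣ a₂` ⟹ `N ≡ ±3 (8)`; Serre's tame inertia: the level-2 fundamental character is Frobenius-conjugated to its square, so the
decomposition group at `2` maps ONTO `S₃ = Aut E[2]` and `2` is inert in `ℚ(√Δ_E) = ℚ(√−N)`; data 74/74 archive + 83/83 D9 prime-conductor
supersingular curves), and the REPAIRED candidate `EdgeFEOddExponentOfEven` (= v5's statement with the binder `(2 : ℤ) ∣ W.frobeniusTrace 2`), with
the kernel reductions `edgeFEOddExponentOfEven_of_chi8 : PrimeConductorEvenTraceModEight → EdgeFEExponentChi8 → EdgeFEOddExponentOfEven` and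
`edgeLevelLambdaSignature_of_feOddOfEven : EdgeFEOddExponentOfEven → EdgeLevelLambdaSignature` (so (R12) ⟸ (Θ-3term) + χ₈-law + Serre).  v5's
`edgeLevelLambdaSignature_of_feOdd` stays (an implication from a refuted hypothesis: valid, vacuous).

**v5 (-an g34, 2026-08-30, MEMO-an §38).**  NEW §(S5) «THE λ-SIGNATURE FROM THE LEVEL FUNCTIONAL EQUATIONS» = the kernel form of
(R12)/P-an-37λ: `IsLevelFE n P w c` (`θ ≡ w·X^c·ιθ (mod X^{2^{n-1}} - 1)`), the bridge `even_add_lambda_of_levelFE` (a level FE with `w` odd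
forces `c + λ(θ) ≡ 0 (mod 2)` once `n ≥ 3`, `λ + 2 ≤ 2^{n-1}`) which IMPORTS THE TREE's characteristic-2 second-coefficient mechanism
`Summit.BirchSwinnertonDyer.Rank1Residual.Supersingular.even_add_natTrailingDegree_of_dvd_charTwo` (`SignedLambdaParityTwoMazurTate` §1,
b2b-bsdres o1 lens-1 GEN 8 / cc-typer-4; the cyclotomic twin `(−1)^{λ(θ_n)} = χ₈(N)`, `Even λ(L♯₂) ↔ N ≡ ±1 (8)`, `Even λ(L♭₂) ↔ N ≡ ±3 (8)`
for all `a₂ ∈ {0, ±2}` is ALREADY the tree's `neg_one_pow_lam_mazurTate_two'` / `even_lam_sharp_two_iff` / `even_lam_flat_two_iff`), the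
parity bookkeeping `parityDeg_mod_two` / `odd_parityDeg_iff` (`q_k` odd iff `k` even), and the theorem `edgeLambdaSignature`: `a` even,
`n ≥ 3`, `IsSharpFlatPair a n P' P S B`, level FEs for `P` (level `n`) and `P'` (level `n+1`) with odd scalars and ODD exponents, `λ(S) = l₁`,
`λ(B) = l₂` in the stabilisation range ⟹ `Odd l₁ ∧ Even l₂`.  The edge-specific input is isolated as the typed candidate `EdgeFEOddExponent`
(FE37 §1: `ιθ_n = w X^{s_n} θ_n`, `s_n` odd on 447/447 level rows of the 74 `a₂`-even archive curves) and `edgeLevelLambdaSignature_of_feOdd :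
EdgeFEOddExponent → EdgeLevelLambdaSignature` is the kernel-checked reduction «(R12) ⟸ (Θ-3term) + (FE-odd)».  No transport matrix, no
fixed-point orders: the g33 paper proof ((i) `M̄_n ≡ diag(1, X̄)` + (ii) fixed-point lemma) is superseded by REF2's three-line route, now in kernel.

Self-contained companion of `SignedEdgeAN47.lean` (§35: the signed `±` edge for `a₂ = 0`) and `EdgeMassFormulaAN45.lean` ((Θ-aug)):
the edge definitions `IsEdgeCMIdeal`, `edgeValue`, `picStep`, `edgeThetaCoeff`, `edgeThetaPoly`, `edgeCharFactor` are COPIED VERBATIM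
(same names, this namespace; the `Cruxes/` files are not importable on the farm).  Attached to crux `RankOneAtTwoBigImageOddLocal`
(stmt-BirchSwinnertonDyer-23715).  SETTING as in AN-45/47: `W/ℚ` of PRIME conductor `N ≡ 3 (mod 4)`, `k = ℚ(i)` (`2` RAMIFIES, `𝔭 = (1+i)`),
definite quaternion algebra of discriminant `N`, Hecke eigenvector `φ` (`Φ = w·φ`), Gross point `(ψ, I)` of conductor `1`, NESTED chain
`J = (J_m)_m` of edge CM ideals, edge theta elements `θ_m ∈ ℤ[G_m]`, `G_m = Pic ℤ[2^m i] ≅ ℤ/2^{m-1}` generated by the class `g` of the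
norm-`5` prime, written as polynomials `P_m(X) = Σ_{j<2^{m-1}} Φ(gʲJ_m) Xʲ`; `F_1 = X - 1`, `F_m = X^{2^{m-2}} + 1 = Φ_{2^{m-1}}(X)` (`m ≥ 2`),
`ω_m := X^{2^{m-1}} - 1 = F_1 F_2 ⋯ F_m`, `D_n := F_2 F_3 ⋯ F_n` (`sharpFlatDenominator`), `T := X - 1`, `a := a₂(W) = W.frobeniusTrace 2`.

§36 — WHAT IS THE SIGNED OBJECT AT 2 WHEN `a₂ = ±2`?  (The residue of §35: for `a₂ = ±2` the single-zero deflation is exact but its `λ` grows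
`0, 1, 4, 17, 68, 275, …`.)  ANSWER: Sprung's `♯/♭` («queue sequence») matrix factorisation, transplanted from the cyclotomic tower
(Sprung 2012/2017, `p = 2` allowed there) and from the definite anticyclotomic tower at `p ≥ 5` SPLIT in `K` (Burungale–Büyükboduk–Lei 2024)
to the definite anticyclotomic EDGE tower at the prime `2` RAMIFIED in `k = ℚ(i)`.  With the three-term relation (Θ-3term) of AN-47,
`ω_n ∣ P_{n+1} - a·P_n + F_n·P_{n-1}` (`n ≥ 2`), i.e. `(P_{n+1}, P_n) ≡ (P_n, P_{n-1})·𝒞_n`, `𝒞_m := [[a, 1], [-F_m, 0]]`, put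
`ℋ_n := 𝒞_2 𝒞_3 ⋯ 𝒞_n` (`det ℋ_n = D_n`, `adj 𝒞_m = [[0, -1], [F_m, a]]`) and DEFINE the level-`n` ♯/♭ pair by
      `(S_n, B_n) := (P_{n+1}, P_n) · adj(ℋ_n) / D_n`,   `adj(ℋ_n) = adj 𝒞_n · adj 𝒞_{n-1} ⋯ adj 𝒞_2`
(`adjChain a n`; one step `(u, v) ↦ (u, v)·adj 𝒞_m = (v·F_m, -u + a·v)` = `sharpFlatStep`; `IsSharpFlatPair a n P_{n+1} P_n S B`).  RESULTS
(engines `MEMO-an-data/g33/ana/sf36.py, chk36.py, tab36.py, gen36.py`, exact integer arithmetic on the g28 T58 theta archive: 127 curves of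
prime conductor `N ≡ 3 (4)`, `N ≤ 36187`, `a₂ = 0` ×36, `±2` ×38, odd ×53; levels `2 ≤ n ≤ 10`; no kit):
* (S1) `SharpFlatDivisibility` — THE DIVISION BY `D_n` IS EXACT IN `ℤ[X]`, for EVERY reduction type: 892/892 level rows (`a₂ = 0`: 254,
  `a₂ = ±2`: 274, `a₂` odd: 364), 0 failures; and `(P_{n+1}, P_n) = (S_n, B_n)·ℋ_n` on the nose.  PROVED BELOW as pure algebra from the
  (Θ-3term) shape: `sharpFlatPair_of_threeTerm` (induction: `(P_{n+1},P_n)·adj 𝒞_n = F_n·(P_n, P_{n-1}) - (0, ω_n e_n)` and `ω_n = (X-1)·D_n`),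
  so (S1) ⟸ `EdgeThreeTermRelation` (AN-47) is a kernel-checked reduction, not a conjecture.  For `a = 0`, `ℋ_n` is (anti)diagonal up to
  the half-products and `S_n = ±Q` (even branch), `B_n = ±Q` (odd branch) are the signed quotients of §35 (control: reproduced exactly).
* (S2) `SharpFlatCompatibility` — `(S_{n+1} - S_n, B_{n+1} - B_n) = ((X-1)·e_{n+1}, 0)·adj(ℋ_{n+1})`, `e_{n+1} := (P_{n+2} - aP_{n+1} + F_{n+1}P_n)/ω_{n+1}`:
  765/765 level pairs (218/236/311), identically (also a by-product of the proof of (S1)).  CONSEQUENCE — THE OBJECT: for `a` EVEN every entry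
  of `adj 𝒞_m ⋯ adj 𝒞_2` lies in the ideal `(2, T)^{m-2}`-ish (`F_m ≡ 2 (mod T)`, `a ≡ 0 (mod 2)`), so `(S_n)_n`, `(B_n)_n` CONVERGE in
  `ℤ₂⟦T⟧`: `L♯_edge(W) := lim S_n`, `L♭_edge(W) := lim B_n` — a pair of bounded 2-adic anticyclotomic `L`-functions of `W` over `ℚ(i)` at the
  RAMIFIED supersingular prime `2`, with `(L_𝟙-values)` `S_n(1) = t₂ = (a-2)(a+1)·Φ(I)/2`, `B_n(1) = t₁ = (a-1)·Φ(I)/2` for all `n` ((Θ-aug) of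
  AN-45: `(t_{n+1}, t_n) = (t₂, t₁)·𝒞(1)^{n-1}`; 127/127), interpolating `(χ(θ_{n+1}), χ(θ_n)) = (χ(S_n), χ(B_n))·χ(ℋ_n)` at every character `χ`
  of `G_n`.  For `a` ODD (ordinary) `adj ℋ` is not contracting and `λ(S_n), λ(B_n)` fluctuate with `n` (53 curves): no object is claimed there.
* (S3) `SharpGenusZero` — AT THE GENUS CHARACTER (`X = -1`, conductor `4`): `F_2(-1) = 0` kills the second row of `𝒞_2(-1)`, so
  `(P_{n+1}(-1), P_n(-1)) = S_n(-1)·(a, 1)·𝒞_3(-1)⋯𝒞_n(-1)` and `B_n` is invisible at the genus values; by Gross's formula for the genus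
  character (`P_n(-1)² ≐ 4^{n-1}·L^alg(W^{(2)})L^alg(W^{(-2)})` up to the (Θ-genus-2) constants) `S_n(-1) = 0` whenever `r_an(W^{(2)}) + r_an(W^{(-2)}) ≥ 1`:
  692/692 level rows (`a₂ = ±2`: 217, `0`: 169, odd: 306); conversely `S_n(-1) ≠ 0` on 200/200 rows of the curves with `r₂ = r₋₂ = 0`.  Support
  (reduction to the genus Gross formula + (S1)).
* (C1) `SharpLeadingTermRankOne` — RANK PATTERN `(r, r₋₁, r₂, r₋₂) = (1,1,0,0)`, `a ∈ {0, ±2}` (20 curves: `a = -2`: 43a1, 347a1, 1019b1, 3851a1,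
  4603a1; `a = +2`: 1747a1, 3347a1, 5443a1; `a = 0`: the twelve §35 curves): AT EVERY LEVEL `n ≥ 2`, `S_n(1) = 0` and `S_n'(1)` is ODD, i.e.
  `L♯_edge = T·(unit)`, `λ♯ = 1`, `μ♯ = 0`: 142/142 level rows (37 + 20 + 85), `λ♯` stable from `n = 2` on.  (For `a = 0` this is
  `EdgeLeadingTermRankOneEven` of AN-47 in ♯-form; the content added here is `a = ±2`.)  MECHANISM as in §35: at `n = 2`, `S_2 = P_2` and
  `S_2'(1) = Φ(gJ₂) = x₁` is odd iff `L^alg(W^{(2)})·L^alg(W^{(-2)})` is odd ((Θ-genus-2): `x₀² = L^alg L^alg` when `t₂ = 0`), and (S2) gives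
  `S_{n+1}'(1) ≡ S_n'(1) (mod 2)` for `a` even (every entry of `(1,0)·adj 𝒞_{n+1}(1)⋯adj 𝒞_2(1)` is even once `n ≥ 2`) — so (C1) ⟸ (S2) +
  «rank-0 `BSD₂`-parity of `W^{(±2)}`»; no exceptional-zero factor appears in the DERIVATIVE for `a = +2` although `S_n(1) = (a-2)(a+1)t₀`
  vanishes identically there.  `λ♭` on these curves: `2` (7/8 of `a = ±2`), `6` (3851a1: five extra roots of slope `1/5`); `ord_{T=0} L♭ = 1`.
  **REF1 §349 (10:08Z): (C1) as typed is KILLED modulo (Θ-genus-2) on 16 even-mass curves `N ≥ 54163` (= AN-47 (Θ-MT⁺)'s kill transported);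
  v2 of this file (10:4xZ) adds the repairs C′ `SharpLeadingTermRankOneUnit` (support; its algebraic core PROVED: `sharpLeadingTerm_of_levelTwo`)
  and C″ `SharpLeadingTermRankOneMass` (candidate), and R349b's `SharpRankZeroGenusLawMinusTwo` ((G2)₋₂ from `n = 2`).**
* (G2) `SharpRankZeroGenusLaw` — RANK PATTERN `(0,0,1,1)`, `a = ±2`, `Φ(I)/2` ODD (all 21 archive curves of this pattern: `a = -2`: 11a1,
  1259c1, 1867a1, 2939a1, 3547c1; `a = +2`: 67a1, 179a1, 307c1, 307d1, 659b1, 739a1, 1171b1, 1187c1, 1907b1, 3203a1, 3331a1, 3907a1, 4451a1,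
  5987c1, [0,1,1,4,-3] (`N = 10099`), [0,-1,1,-14,-17] (`N = 11059`)): `B_n` is a UNIT of `ℤ₂⟦T⟧` (`B_n(1) = (a-1)t₀` odd; 154/154 rows) and
  THE ♯ VALUATION LAW `v₂(S_n'(1)) = 1 + [a = 2]` for all `n ≥ 5`: `a = -2`: `S_n(1) = 4t₀`, `2 ∥ S_n'(1)` (37/37 rows, in fact from `n = 2`
  on, with `S_n'(1) ≡ S_n(1)/2 (mod 4)`); `a = +2`: `S_n(1) = 0`, `4 ∥ S_n'(1)` (69/69 rows `n ≥ 5`; at `n ≤ 4` not yet stable: `θ₂ = 0`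
  identically, 16 + 3 + 10 early rows differ); uniformly 91/91 rows `n ≥ 5` on 21 curves, 0 exceptions.  STRUCTURE READ OFF (tab36/gen36,
  reported not typed): `λ♯ ≥ 3` and odd — `a = -2`: `L♯ = (T+2)·R·u`, `v₂(R(0)) = 1 + v₂(t₀)… = ` genus zero SIMPLE, the remaining `λ♯ - 1`
  roots a slope-`1/2` pair (`λ♯ = 3`: 11a1, 1867a1, 3547c1), a slope-`1/4` quadruple (1259c1, `λ♯ = 5`) or ten of slope `1/10` (2939a1,
  `λ♯ = 11`); `a = +2`: `L♯ = T·(T+2)·R·u`, the zero at `𝟙` and the genus zero both SIMPLE, `v₂(L♯'(0)) = 2`, `λ♯ = 3` ×12, `5` ×3 (67a1,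
  3203a1, 11059: a slope-`1/3` triple… pair), `7` (1907b1, slope `1/5`).  `λ♯ ≥ 3` itself is forced (genus zero (S3) + value + V12
  `λ`-parity); the non-forced content typed in (G2) is the EXACT valuation of the derivative at `𝟙` (genus-zero simplicity for `a = -2`,
  the «ℒ-type» valuation `2` for `a = +2`).
* (S4) MOD 2 THE ♯/♭ PAIR IS THE ± PAIR (v3 of this file, 11:1xZ, KERNEL-CHECKED `sharpFlat_mod_two`): for `a` even and every ♯/♭ pair,
  `θ_L ≡ S·ω̃_L` (`L` even), `θ_L ≡ B·ω̃_L` (`L` odd) modulo `2ℤ[X]`, `ω̃_L = ∏_{2 ≤ m < L, m ≢ L (2)} F_m = parityProd (L-1)` AN-47's signed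
  trivial factor (one adjugate step is `(u, v) ↦ (v·F_m, -u + a·v) ≡ (v·F_m, u) (mod 2)`, then cancel the monic `Π`'s against the prime `2` of
  `ℤ[X]`).  Hence, with `μ = 0` (V12), `λ(θ_L) = λ♯ + deg ω̃_L` at EVEN levels and `λ(θ_L) = λ♭ + deg ω̃_L` at ODD levels — the even levels of the
  edge tower see `L♯`, the odd levels `L♭`, although `a₂ = ±2 ≠ 0`; census: `λ(θ_n) - λ(S_n) = Σ_{k odd, 3≤k≤n-1} 2^{k-2}` (`n` even),
  `λ(θ_n) - λ(B_n) = Σ_{k even, 2≤k≤n-1} 2^{k-2}` (`n` odd) on 148/148 rows (74 `a₂`-even curves × two top levels; tab36_out.json), e.g. 11a1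
  `λ(θ_8) = 45 = 3 + 42`, `λ(θ_9) = 85 = 0 + 85`, 2939a1 `λ(θ_8) = 53 = 11 + 42`.  So `λ♯ = λ(θ_L) - deg ω̃_L = λ(θ_L) - 2(4^{L/2-1} - 1)/3`
  for every even `L ≥ 4` (and `λ♭ = λ(θ_L) - (4^{(L-1)/2} - 1)/3`, `L ≥ 3` odd): the ♯/♭-invariants ARE the stabilised even/odd-level `λ` of
  the printed Mazur–Tate-type elements (Pollack's `q_n` shape, at the ramified prime 2 of the anticyclotomic tower).  v4 (11:0xZ)
  makes the λ-statement itself a KERNEL THEOREM: (S4λ) `sharpFlat_lambda_shift` — in V12's `μ = 0` encoding `HasLambda P l` («the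
  `T`-coefficients of `P` below `l` are even, the `l`-th is odd», `T = X - 1`), `HasLambda S l ↔ HasLambda θ_n (l + q_{n-1})` for `n` even
  (resp. `B` for `n` odd, and the level-`n+1` companions), `q_k = deg Π_k = parityDeg k` (`1, 2, 5, 10, 21, 42, 85, …`), via
  `taylor_coeff_mod_two_shift` (the mod-2 `T`-expansion of `θ_L` is that of `S`/`B` shifted by `deg ω̃_L`; Frobenius
  `F_m(T+1) ≡ T^{2^{m-2}}` in `𝔽₂[T]`).
NOTHING HERE IS A THEOREM BEYOND PRINT.  (S1) is PROVED below modulo (Θ-3term) (elementary algebra); (S4) and (S4λ) are PROVED outright (mod-2 algebra of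
the chain + Frobenius); (S2), (S3) are theorem-SHAPE support;
(C1), (G2) are CANDIDATES with census37 as BC5 witness; BSD is not touched.  PRINT PLACEMENT (presearch, corpus + galaxy, -an g33):
the ♯/♭ CONSTRUCTION is Sprung's [corpus: doi:10.1016/j.jnt.2011.11.003 pp. 1484–1486, `p = 2` included, cyclotomic; arXiv:1211.1352 Def. 6.19
(`𝒞_i(a, 1+T) = [[a,1],[-ε(p)Φ_{p^i}(1+T),0]]`), Conj. 5.20 «separated `p`-adic BSD» incl. `p = 2`, Thm 6.15]; its anticyclotomic definite
version exists for `p ≥ 5` SPLIT in `K`, `a_p ≠ 0` [corpus: arXiv:1605.05310 §1 (`p ≥ 5`, `(p) = 𝔭𝔭ᶜ`); arXiv:2211.03722 §1 («Sprung-type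
factorisation», bounded `L_p(f,K)♯/♭`, `p` split or inert, `p ≥ 5`)]; NO ♯/♭ or `±` object at a prime RAMIFIED in `K`, and none at `p = 2`
in the anticyclotomic direction, was found (corpus fts+vec: «sharp flat supersingular a_p nonzero», vsearch of the construction; galaxy
`--star all/pdf`: "pair of main conjectures|sharp and flat|chromatic Selmer|signed Selmer groups", "flat p-adic L-function|sharp p-adic
L-function|signed Heegner points", "supersingular primes|non-ordinary primes" → only Pollack–Weston MT-elements [galaxy:pdf:-6535538855114364040]
and BLLV 2019 [galaxy:pdf:-2774205897228378480], both `p` odd).  So: OBJECT = VARIANT (transplant with the dictionary `Φ_{pⁿ}(1+T) ↦ F_{n+1}(X)`,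
`Mazur–Tate/theta element ↦ edge theta element θ_n`, `ε(p) = 1`); LAWS (C1)/(G2) at `p = 2 | disc k` = beyond-print DATA, conjecture-shape
(Sprung Conj. 5.20 / Bertolini–Darmon 1996 Conj. 4.x analogues).  SOURCES: Sprung 2012 [doi:10.1016/j.jnt.2011.11.003], Sprung 2012b
[arXiv:1211.1352], Sprung 2017 [doi:10.2140/ant.2017.11.885]; Büyükboduk–Lei [arXiv:1605.05310]; Burungale–Büyükboduk–Lei [arXiv:2211.03722];
Darmon–Iovita 2008 [doi:10.1017/S1474748007000126]; Bertolini–Darmon 1996 [doi:10.1007/s002220050105]; Pollack 2003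
[doi:10.1215/S0012-7094-03-11835-9]; Kurihara–Otsuki 2006 (`a₂ = ±2`, cyclotomic 2-part of Ш); Gross 1987 §11; census36, census37. -/

namespace Summit.BirchSwinnertonDyer.BirchSwinnertonDyer.Cruxes.RankOneAtTwoBigImageOddLocal.SharpFlat

open Literature.NumberTheory.Automorphic Literature.NumberTheory.Automorphic.Brandt
open Literature.NumberTheory.EllipticCurves
open scoped NumberField nonZeroDivisors Pointwise Polynomial

variable {D : Type} [Ring D] [Algebra ℚ D] {k : Type} [Field k] [NumberField k]

/-- COPY of `DefiniteMod2Waldspurger.V12.IsEdgeCMIdeal` (AN43/AN47): level-`n` edge CM sub-ideal of the based Gross point `(ψ, I)` at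
the ramified prime (`J ⊆ I` invertible right `O`-ideal of index `4ⁿ`, primitive, on the `I`-side of the edge `{I, ψ(𝔭)I}`). -/
def IsEdgeCMIdeal (O : Submodule ℤ D) (ψ : k →ₐ[ℚ] D) (I : Submodule ℤ D) (𝔭 : Ideal (𝓞 k)) (n : ℕ)
    (J : Submodule ℤ D) : Prop :=
  J ∈ Brandt.rightIdeals O ∧ J ≤ I ∧ J.toAddSubgroup.relIndex I.toAddSubgroup = 4 ^ n ∧
    ¬ J ≤ Brandt.grossTranslate ψ (Ideal.span {(2 : 𝓞 k)}) I ∧ ¬ J ≤ Brandt.grossTranslate ψ 𝔭 I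

/-- COPY of `V12.edgeValue` (AN43/AN47): `Φ(J) = w_{[J]}·φ([J])`. -/
noncomputable def edgeValue (O : Submodule ℤ D) (φ : Brandt.ClassSet O → ℤ) (J : Submodule ℤ D) : ℤ :=
  (Brandt.unitIndex (Brandt.leftOrder J) : ℤ) * Brandt.evalAtLattice φ J

/-- COPY of `V12.picStep` (AN43/AN47): the CM translate by the class `g` of the norm-`5` prime `(1 + 2i₀)`, a generator of
`Pic ℤ[2ⁿ i] ≅ ℤ/2ⁿ⁻¹`. -/
def picStep (ψ : k →ₐ[ℚ] D) (i₀ : k) (n : ℕ) (J : Submodule ℤ D) : Submodule ℤ D :=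
  AddSubgroup.toIntSubmodule
    (J.toAddSubgroup ⊓ ((J.toAddSubgroup.map (AddMonoidHom.mulLeft (5 : D))).comap
      (AddMonoidHom.mulLeft (ψ ((2 : k) ^ n * (1 - 2 * i₀))))))

/-- COPY of `V12.edgeThetaCoeff` (AN43/AN47): `c_j = Φ(gʲ J₀)`, the `j`-th coefficient of `θ_n(J₀) = Σ_{j<2ⁿ⁻¹} c_j [gʲ]`. -/
noncomputable def edgeThetaCoeff (O : Submodule ℤ D) (φ : Brandt.ClassSet O → ℤ) (ψ : k →ₐ[ℚ] D) (i₀ : k)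
    (n : ℕ) (J₀ : Submodule ℤ D) (j : ℕ) : ℤ :=
  edgeValue O φ ((picStep ψ i₀ n)^[j] J₀)

/-- COPY of AN-45/47 `edgeThetaPoly`: `θ_n` as an integer polynomial `P_n = Σ_{j<2ⁿ⁻¹} c_j Xʲ` (`X ↔ g`; `ℤ[G_n] = ℤ[X]/(X^{2ⁿ⁻¹} - 1)`). -/
noncomputable def edgeThetaPoly (O : Submodule ℤ D) (φ : Brandt.ClassSet O → ℤ) (ψ : k →ₐ[ℚ] D) (i₀ : k)
    (n : ℕ) (J₀ : Submodule ℤ D) : ℤ[X] :=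
  ∑ j ∈ Finset.range (2 ^ (n - 1)), Polynomial.C (edgeThetaCoeff O φ ψ i₀ n J₀ j) * Polynomial.X ^ j

/-- COPY of AN-45/47 `edgeCharFactor`: the level-`m` CHARACTER FACTOR of `X^{2ⁿ⁻¹} - 1 = ∏_{m ≤ n} F_m`: `F_1 = X - 1`,
`F_m = Φ_{2^{m-1}}(X) = X^{2^{m-2}} + 1` for `m ≥ 2` (`m = 2`: the genus character `g ↦ -1`). -/
noncomputable def edgeCharFactor (m : ℕ) : ℤ[X] :=
  if m ≤ 1 then Polynomial.X - 1 else Polynomial.X ^ (2 ^ (m - 2)) + 1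

/-- NEW (§36): ONE ADJUGATE STEP of the ♯/♭ factorisation: the row action of `adj 𝒞_m = [[0, -1], [F_m, a]]`,
`(u, v) ↦ (u, v)·adj 𝒞_m = (v·F_m, -u + a·v)` (`𝒞_m = [[a, 1], [-F_m, 0]]` is the transfer matrix of the three-term relation
`(P_{m+1}, P_m) ≡ (P_m, P_{m-1})·𝒞_m`; Sprung's `𝒞_i(a, 1+T)` with `Φ_{2^{m-1}}(X)` for `Φ_{pⁱ}(1+T)`). -/
noncomputable def sharpFlatStep (a : ℤ) (m : ℕ) (uv : ℤ[X] × ℤ[X]) : ℤ[X] × ℤ[X] :=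
  (uv.2 * edgeCharFactor m, -uv.1 + Polynomial.C a * uv.2)

/-- NEW (§36): THE ADJUGATE CHAIN `(u, v) ↦ (u, v)·adj(ℋ_n) = (u, v)·adj 𝒞_n·adj 𝒞_{n-1}⋯adj 𝒞_2` (`ℋ_n = 𝒞_2⋯𝒞_n`; the identity for
`n ≤ 1`). -/
noncomputable def adjChain (a : ℤ) : ℕ → ℤ[X] × ℤ[X] → ℤ[X] × ℤ[X]
  | 0, uv => uv
  | 1, uv => uv
  | (n + 2), uv => adjChain a (n + 1) (sharpFlatStep a (n + 2) uv)

/-- NEW (§36): THE ♯/♭ DENOMINATOR `D_n = det ℋ_n = F_2 F_3 ⋯ F_n = (X^{2^{n-1}} - 1)/(X - 1)` (`sharpFlatDenominator_mul`). -/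
noncomputable def sharpFlatDenominator (n : ℕ) : ℤ[X] :=
  ∏ m ∈ Finset.Icc 2 n, edgeCharFactor m

/-- NEW (§36): `(S, B)` IS THE LEVEL-`n` ♯/♭ PAIR of `(P', P) = (P_{n+1}, P_n)` for the trace `a`:
`(P_{n+1}, P_n)·adj(ℋ_n) = D_n·(S, B)` in `ℤ[X] × ℤ[X]` — i.e. `(S_n, B_n) = (P_{n+1}, P_n)·ℋ_n⁻¹` with the division EXACT
(`ℤ[X]` is a domain, so the pair is unique when it exists). -/
def IsSharpFlatPair (a : ℤ) (n : ℕ) (P' P S B : ℤ[X]) : Prop :=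
  adjChain a n (P', P) = (sharpFlatDenominator n * S, sharpFlatDenominator n * B)

/-- **(S1) `SharpFlatDivisibility` — the ♯/♭ pair EXISTS INTEGRALLY at every level, for every reduction type (support; PROVED below from the
(Θ-3term) shape: `sharpFlatPair_of_threeTerm`, so (S1) ⟸ `SignedEdge.EdgeThreeTermRelation` of AN-47).**  `W` of prime conductor `N ≡ 3 (4)`,
`J` a nested chain of edge CM ideals: for every `n ≥ 2` there are `S_n, B_n ∈ ℤ[X]` with `(P_{n+1}, P_n)·adj(𝒞_2⋯𝒞_n) = F_2⋯F_n·(S_n, B_n)`,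
`a = a₂(W)`.  DATA = BC5 WITNESS: 892/892 level rows `2 ≤ n ≤ 10` on all 127 archive curves (`a₂ = 0`: 254, `±2`: 274, odd: 364), exact
polynomial division (sf36.py).  WHY IT MIGHT FAIL: only through (Θ-3term) (T58-verified 892/892; typed set-up of `picStep`).  SOURCES: Sprung
2012 [doi:10.1016/j.jnt.2011.11.003] §§2–4; Sprung [arXiv:1211.1352] Def. 6.19–6.24 (queue sequences); Büyükboduk–Lei [arXiv:1605.05310] Prop. 2.? 
(`(P_{♯,n}, P_{♭,n})`, `p ≥ 5` split); census37 §A. -/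
def SharpFlatDivisibility : Prop :=
  ∀ (W : WeierstrassCurve ℚ) [W.IsElliptic] [W.IsGloballyMinimal] (N : ℕ),
    N.Prime → N % 4 = 3 → W.conductorNorm ℤ = N →
  ∀ (k : Type) [Field k] [NumberField k], IsImaginaryQuadratic k → NumberField.discr k = -4 →
  ∀ (i₀ : k), i₀ ^ 2 = -1 → ∀ (𝔭 : Ideal (𝓞 k)), 𝔭 ^ 2 = Ideal.span {(2 : 𝓞 k)} →
  ∀ (S : Brandt.XiSetup 1 N) [Fintype (Brandt.ClassSet S.O)] (φ : Brandt.ClassSet S.O → ℤ) (ψ : k →ₐ[ℚ] S.D)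
    (I : Submodule ℤ S.D), Brandt.IsGrossPoint S.O ψ I →
    φ ≠ 0 → Brandt.eigenLattice N (Brandt.matrix S.O) (fun p => W.frobeniusTrace p) = ℤ ∙ φ →
  ∀ (J : ℕ → Submodule ℤ S.D), (∀ m ≥ 1, IsEdgeCMIdeal S.O ψ I 𝔭 m (J m)) → (∀ m ≥ 1, J (m + 1) ≤ J m) →
  ∀ n ≥ 2, ∃ Sn Bn : ℤ[X],
    IsSharpFlatPair (W.frobeniusTrace 2) n (edgeThetaPoly S.O φ ψ i₀ (n + 1) (J (n + 1))) (edgeThetaPoly S.O φ ψ i₀ n (J n)) Sn Bn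

/-- **(S2) `SharpFlatCompatibility` — consecutive ♯/♭ pairs differ by `((X-1)·e, 0)·adj(ℋ_{n+1})`; hence `L♯_edge := lim S_n`,
`L♭_edge := lim B_n` exist in `ℤ₂⟦X-1⟧` for `a` even (support; theorem-shape corollary of (Θ-3term), -an g33 §36).**  For every `n ≥ 2` and
all ♯/♭ pairs `(S, B)` at level `n`, `(S', B')` at level `n+1` of the same nested chain: `∃ e ∈ ℤ[X]`,
`(S' - S, B' - B) = ((X - 1)·e, 0)·adj 𝒞_{n+1}⋯adj 𝒞_2` (`e = e_{n+1} = (P_{n+2} - aP_{n+1} + F_{n+1}P_n)/(X^{2ⁿ} - 1)`).  DATA = BC5 WITNESS: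
765/765 level pairs (`a₂ = 0`: 218, `±2`: 236, odd: 311), identically (chk36.py COMPAT).  WHY IT MIGHT FAIL: only with (Θ-3term).  SOURCES:
Sprung 2012 §4 (`Col♯/♭` as limits); Darmon–Iovita 2008 §2 [doi:10.1017/S1474748007000126]; Burungale–Büyükboduk–Lei [arXiv:2211.03722] §2;
census37 §A. -/
def SharpFlatCompatibility : Prop :=
  ∀ (W : WeierstrassCurve ℚ) [W.IsElliptic] [W.IsGloballyMinimal] (N : ℕ),
    N.Prime → N % 4 = 3 → W.conductorNorm ℤ = N →
  ∀ (k : Type) [Field k] [NumberField k], IsImaginaryQuadratic k → NumberField.discr k = -4 →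
  ∀ (i₀ : k), i₀ ^ 2 = -1 → ∀ (𝔭 : Ideal (𝓞 k)), 𝔭 ^ 2 = Ideal.span {(2 : 𝓞 k)} →
  ∀ (S : Brandt.XiSetup 1 N) [Fintype (Brandt.ClassSet S.O)] (φ : Brandt.ClassSet S.O → ℤ) (ψ : k →ₐ[ℚ] S.D)
    (I : Submodule ℤ S.D), Brandt.IsGrossPoint S.O ψ I →
    φ ≠ 0 → Brandt.eigenLattice N (Brandt.matrix S.O) (fun p => W.frobeniusTrace p) = ℤ ∙ φ →
  ∀ (J : ℕ → Submodule ℤ S.D), (∀ m ≥ 1, IsEdgeCMIdeal S.O ψ I 𝔭 m (J m)) → (∀ m ≥ 1, J (m + 1) ≤ J m) →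
  ∀ n ≥ 2, ∀ (Sn Bn Sn' Bn' : ℤ[X]),
    IsSharpFlatPair (W.frobeniusTrace 2) n (edgeThetaPoly S.O φ ψ i₀ (n + 1) (J (n + 1))) (edgeThetaPoly S.O φ ψ i₀ n (J n)) Sn Bn →
    IsSharpFlatPair (W.frobeniusTrace 2) (n + 1) (edgeThetaPoly S.O φ ψ i₀ (n + 2) (J (n + 2)))
      (edgeThetaPoly S.O φ ψ i₀ (n + 1) (J (n + 1))) Sn' Bn' →
    ∃ e : ℤ[X], adjChain (W.frobeniusTrace 2) (n + 1) ((Polynomial.X - 1) * e, 0) = (Sn' - Sn, Bn' - Bn)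

/-- **(S3) `SharpGenusZero` — the ♯ function vanishes at the GENUS character whenever a twist by `±2` has positive rank (support; reduction to
the genus Gross formula + (S1), -an g33 §36).**  ALL reduction types: if `r_an(W^{(2)}) ≥ 1` or `r_an(W^{(-2)}) ≥ 1` then `S_n(-1) = 0` for every
`n ≥ 2` and every ♯/♭ pair (`F_2(-1) = 0` makes `(P_{n+1}(-1), P_n(-1)) = S_n(-1)·(a,1)·𝒞_3(-1)⋯𝒞_n(-1)`, and `P_n(-1) = 0` is the genus value).
DATA = BC5 WITNESS: 692/692 level rows on the curves with `r₂ + r₋₂ ≥ 1` (`a₂ = ±2`: 217, `0`: 169, odd: 306); converse `S_n(-1) ≠ 0` on 200/200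
rows with `r₂ = r₋₂ = 0` (gen36.py).  WHY IT MIGHT FAIL: only if the genus-character value of `θ_n` failed to be `± 2^{?}·x_genus` (it is (Θ-gen) of
AN-45, 127/127).  SOURCES: Gross 1987 §11 (values at genus characters) [Gross1987Heights]; Bertolini–Darmon 1996 §2 [doi:10.1007/s002220050105];
census37 §A. -/
def SharpGenusZero : Prop :=
  ∀ (W : WeierstrassCurve ℚ) [W.IsElliptic] [W.IsGloballyMinimal] (N : ℕ),
    N.Prime → N % 4 = 3 → W.conductorNorm ℤ = N →
  ∀ (W₂ : WeierstrassCurve ℚ) [W₂.IsElliptic] [W₂.IsGloballyMinimal] (C₂ : WeierstrassCurve.VariableChange ℚ),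
    C₂ • W₂ = W.quadraticTwist (2 : ℚ) →
  ∀ (W₃ : WeierstrassCurve ℚ) [W₃.IsElliptic] [W₃.IsGloballyMinimal] (C₃ : WeierstrassCurve.VariableChange ℚ),
    C₃ • W₃ = W.quadraticTwist (-2 : ℚ) → (1 ≤ W₂.analyticRank ∨ 1 ≤ W₃.analyticRank) →
  ∀ (k : Type) [Field k] [NumberField k], IsImaginaryQuadratic k → NumberField.discr k = -4 →
  ∀ (i₀ : k), i₀ ^ 2 = -1 → ∀ (𝔭 : Ideal (𝓞 k)), 𝔭 ^ 2 = Ideal.span {(2 : 𝓞 k)} →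
  ∀ (S : Brandt.XiSetup 1 N) [Fintype (Brandt.ClassSet S.O)] (φ : Brandt.ClassSet S.O → ℤ) (ψ : k →ₐ[ℚ] S.D)
    (I : Submodule ℤ S.D), Brandt.IsGrossPoint S.O ψ I →
    φ ≠ 0 → Brandt.eigenLattice N (Brandt.matrix S.O) (fun p => W.frobeniusTrace p) = ℤ ∙ φ →
  ∀ (J : ℕ → Submodule ℤ S.D), (∀ m ≥ 1, IsEdgeCMIdeal S.O ψ I 𝔭 m (J m)) → (∀ m ≥ 1, J (m + 1) ≤ J m) →
  ∀ n ≥ 2, ∀ (Sn Bn : ℤ[X]),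
    IsSharpFlatPair (W.frobeniusTrace 2) n (edgeThetaPoly S.O φ ψ i₀ (n + 1) (J (n + 1))) (edgeThetaPoly S.O φ ψ i₀ n (J n)) Sn Bn →
    Sn.eval (-1) = 0

/-- **(C1) `SharpLeadingTermRankOne` — for the supersingular rank-`(1,1,0,0)` curves `L♯_edge = T·(unit)`: `λ♯ = 1`, `μ♯ = 0` (candidate, -an g33
§36; beyond print; the crux's own population for `a₂ ∈ {0, ±2}`).**  `W` of prime conductor `N ≡ 3 (mod 4)`, `a₂` EVEN, `r_an(W) = r_an(W^{(-1)}) = 1`,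
`r_an(W^{(2)}) = r_an(W^{(-2)}) = 0`; `J` a nested chain of edge CM ideals.  Then for every `n ≥ 2` and every ♯/♭ pair `(S_n, B_n)`: `S_n(1) = 0` and
`S_n'(1)` is ODD.  READING (Sprung's separated `p`-adic BSD, Conj. 5.20 of arXiv:1211.1352, transplanted; Bertolini–Darmon dictionary at
`p = 2 | disc k`): `ord_{T=0} L♯_edge = 1 = max(r, r₋₁)` and the ♯ leading coefficient is a 2-adic UNIT — the analytic shadow of
`BSD₂(W) ∧ BSD₂(W^{(-1)})` with trivial 2-parts (all 20 archive curves have `Ш_an·∏c_v·#tors = 1`-type 2-parts for `W`, `W^{(-1)}`: consistency, not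
yet a test — data ask D-an-35b).  (C1) ⟸ (S2) + «`L^alg(W^{(2)})L^alg(W^{(-2)})` odd», see the file header.  DATA = BC5 WITNESS: 20/20 curves,
142/142 level rows `2 ≤ n ≤ 10` (`a = -2`: 43a1, 347a1, 1019b1, 3851a1, 4603a1 — 37 rows; `a = +2`: 1747a1, 3347a1, 5443a1 — 20 rows; `a = 0`:
131a1, 163a1, 443a1, 467a1, 811a1, 827a1, 1019a1, 1811a1, 3251a1, 3547a1, 4051a1, 5563a1 — 85 rows), 0 exceptions (chk36.py C1).  WHY IT MIGHT
FAIL: a curve of this pattern with `L^alg(W^{(2)})·L^alg(W^{(-2)})` EVEN (`Ш(W^{(±2)})[2] ≠ 0` or an even Tamagawa number of a twist at the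
additive prime `2`) breaks it at `n = 2` — and REF1 found them: 16 of 447 rank-1 optimal classes `N < 5·10⁵` of this pattern have EVEN
mass `L^alg(W^{(2)})L^alg(W^{(-2)}) = 16` (`(Ш_an(W₂), Ш_an(W₋₂)) = (4,4)`; first `54163a` for `a₂ = 0`, `99251a` for `a₂ = ±2`; none below, so
the 20 archive curves `N ≤ 5563` cannot see it) [REF1-AUDIT §343-add1, §349; kit j339512/j339524/j339818].  **VERDICT (REF1 §349, 2026-08-30T10:08Z):
KILLED modulo (Θ-genus-2), class refuted-misstated (formally pending the one genus-level datum D-an-35b′: `x₀(54163a) = ±4` predicted);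
(C1) adds NOTHING beyond level 2** — `S_2 = P_2 = θ₂` (`sharp_two_eq` below) and the value `S_n(1)` and the PARITY of `S_n'(1)` are
level-independent (`sharp_eval_one_succ` below, from (Θ-3term) alone, every `a`), so (C1) ⟺ `t₂ = 0 ∧ x₁ odd` ⟺ «mass odd».  REPAIRS typed
below: C′ = `SharpLeadingTermRankOneUnit` (hypothesis `x₁` odd; a COROLLARY — PROVED here as `sharpLeadingTerm_of_levelTwo` modulo (Θ-3term)
and Gross's `t₂ = 0`) and C″ = `SharpLeadingTermRankOneMass` (`v₂(S_n'(1)) = v₂(x₁)` at every level — a genuine candidate exactly on the 16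
even-mass curves, decided by D-an-36 (c)).  The decl below is kept verbatim as the refuted-misstated edge.  SOURCES: Sprung
[arXiv:1211.1352] Conj. 5.20, Lemma 5.19; Mazur–Tate 1987 [doi:10.1215/S0012-7094-87-05431-7]; Bertolini–Darmon 1996 Conj. 4.1(1), 4.4 (definite case: order of vanishing `max(r̃⁺, r̃⁻)`, leading term in `I^s/I^{s+1}`) [doi:10.1007/s002220050105, p. 445 L38, p. 446 L25];
Kurihara 2002 [doi:10.1007/s002220100206]; AN-47 `EdgeLeadingTermRankOneEven`; census37 §B. -/
def SharpLeadingTermRankOne : Prop :=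
  ∀ (W : WeierstrassCurve ℚ) [W.IsElliptic] [W.IsGloballyMinimal] (N : ℕ),
    N.Prime → N % 4 = 3 → W.conductorNorm ℤ = N → (2 : ℤ) ∣ W.frobeniusTrace 2 → W.analyticRank = 1 →
  ∀ (W₁ : WeierstrassCurve ℚ) [W₁.IsElliptic] [W₁.IsGloballyMinimal] (C₁ : WeierstrassCurve.VariableChange ℚ),
    C₁ • W₁ = W.quadraticTwist (-1 : ℚ) → W₁.analyticRank = 1 →
  ∀ (W₂ : WeierstrassCurve ℚ) [W₂.IsElliptic] [W₂.IsGloballyMinimal] (C₂ : WeierstrassCurve.VariableChange ℚ),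
    C₂ • W₂ = W.quadraticTwist (2 : ℚ) → W₂.analyticRank = 0 →
  ∀ (W₃ : WeierstrassCurve ℚ) [W₃.IsElliptic] [W₃.IsGloballyMinimal] (C₃ : WeierstrassCurve.VariableChange ℚ),
    C₃ • W₃ = W.quadraticTwist (-2 : ℚ) → W₃.analyticRank = 0 →
  ∀ (k : Type) [Field k] [NumberField k], IsImaginaryQuadratic k → NumberField.discr k = -4 →
  ∀ (i₀ : k), i₀ ^ 2 = -1 → ∀ (𝔭 : Ideal (𝓞 k)), 𝔭 ^ 2 = Ideal.span {(2 : 𝓞 k)} →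
  ∀ (S : Brandt.XiSetup 1 N) [Fintype (Brandt.ClassSet S.O)] (φ : Brandt.ClassSet S.O → ℤ) (ψ : k →ₐ[ℚ] S.D)
    (I : Submodule ℤ S.D), Brandt.IsGrossPoint S.O ψ I →
    φ ≠ 0 → Brandt.eigenLattice N (Brandt.matrix S.O) (fun p => W.frobeniusTrace p) = ℤ ∙ φ →
  ∀ (J : ℕ → Submodule ℤ S.D), (∀ m ≥ 1, IsEdgeCMIdeal S.O ψ I 𝔭 m (J m)) → (∀ m ≥ 1, J (m + 1) ≤ J m) →
  ∀ n ≥ 2, ∀ (Sn Bn : ℤ[X]),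
    IsSharpFlatPair (W.frobeniusTrace 2) n (edgeThetaPoly S.O φ ψ i₀ (n + 1) (J (n + 1))) (edgeThetaPoly S.O φ ψ i₀ n (J n)) Sn Bn →
    Sn.eval 1 = 0 ∧ ¬ (2 : ℤ) ∣ (Polynomial.derivative Sn).eval 1

/-- **(G2) `SharpRankZeroGenusLaw` — the ♯ VALUATION LAW `v₂(L♯_edge'(0)) = 1 + [a₂ = 2]` for the rank-`(0,0,1,1)` curves with `a₂ = ±2`
and `Φ(I)/2` odd (candidate, -an g33 §36; beyond print).**  `W` of prime conductor `N ≡ 3 (mod 4)`, `a₂ = ±2`, `r_an(W) = r_an(W^{(-1)}) = 0`,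
`r_an(W^{(2)}) = r_an(W^{(-2)}) = 1`, `2 ∥ Φ(I)` (`Φ = w·φ` at the Gross point; `(Φ(I)/2)² ≐ L^alg(W)L^alg(W^{(-1)})`, so: odd central 2-parts);
`J` a nested chain of edge CM ideals.  Then for every `n ≥ 5` and every ♯/♭ pair, with `d := S_n'(1)`: if `a₂ = 2`, `S_n(1) = 0` and `4 ∥ d`;
if `a₂ = -2`, `2 ∥ d` (and `S_n(1) = 4·Φ(I)/2` by (Θ-aug)).  Together with (S3) (genus zero) and `B_n` a unit this pins the shape
`L♯_edge = (T+2)·R·u` (`a = -2`, genus zero SIMPLE) resp. `T·(T+2)·R·u` (`a = +2`, `v₂(L♯'(0)) = 2`: an «ℒ-invariant-type» valuation at the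
zero forced by `t₂ = (a-2)(a+1)Φ(I)/2 = 0`), `R(0) ≠ 0`, `λ♯ = 1 + [a=2] + λ(R) ≥ 3` odd.  DATA = BC5 WITNESS: 21/21 curves (`a = -2`: 11a1, 1259c1,
1867a1, 2939a1, 3547c1; `a = +2`: 67a1, 179a1, 307c1, 307d1, 659b1, 739a1, 1171b1, 1187c1, 1907b1, 3203a1, 3331a1, 3907a1, 4451a1, 5987c1,
`[0,1,1,4,-3]` (`N = 10099`), `[0,-1,1,-14,-17]` (`N = 11059`)), 91/91 level rows `5 ≤ n ≤ 10`, 0 exceptions (`a = -2` holds from `n = 2`: 37/37;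
`a = +2` stabilises only at `n = 5`: `θ₂ = 0`, and 3 + 10 rows at `n = 3, 4` differ) (chk36.py G2).  WHY IT MIGHT FAIL: it encodes trivial
2-parts of `Ш` and Tamagawa numbers of `W^{(±2)}` (rank 1) and a UNIT 2-adic BD-height of their Heegner points; a curve with `v₂(Φ(I)) = 1` but a
non-unit height/`Ш(W^{(±2)})[2]` would give `v₂(d) > 1 + [a=2]` — the honest law is `v₂(d) = 1 + [a=2] + (height + Ш + Tamagawa 2-adic
valuations of the twists)`; no such curve has `N ≤ 11059` (data ask D-an-36).  SOURCES: Sprung [arXiv:1211.1352] Conj. 5.20 (the `a_p = 2`/`p = 2`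
exceptional cases of `r♯, r♭`), Lemma 5.19; Bertolini–Darmon 1996 §§2.7–2.11, Conj. 4.1(1), 4.4 (definite case; there `p ∥ N`, here `p = 2 ∤ N` ramified in `K` — structural analogue only) [doi:10.1007/s002220050105]; Kurihara–Otsuki 2006 (`a₂ = ±2`);
Gross 1987 §11; census37 §C. -/
def SharpRankZeroGenusLaw : Prop :=
  ∀ (W : WeierstrassCurve ℚ) [W.IsElliptic] [W.IsGloballyMinimal] (N : ℕ),
    N.Prime → N % 4 = 3 → W.conductorNorm ℤ = N → (W.frobeniusTrace 2 = 2 ∨ W.frobeniusTrace 2 = -2) → W.analyticRank = 0 →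
  ∀ (W₁ : WeierstrassCurve ℚ) [W₁.IsElliptic] [W₁.IsGloballyMinimal] (C₁ : WeierstrassCurve.VariableChange ℚ),
    C₁ • W₁ = W.quadraticTwist (-1 : ℚ) → W₁.analyticRank = 0 →
  ∀ (W₂ : WeierstrassCurve ℚ) [W₂.IsElliptic] [W₂.IsGloballyMinimal] (C₂ : WeierstrassCurve.VariableChange ℚ),
    C₂ • W₂ = W.quadraticTwist (2 : ℚ) → W₂.analyticRank = 1 →
  ∀ (W₃ : WeierstrassCurve ℚ) [W₃.IsElliptic] [W₃.IsGloballyMinimal] (C₃ : WeierstrassCurve.VariableChange ℚ),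
    C₃ • W₃ = W.quadraticTwist (-2 : ℚ) → W₃.analyticRank = 1 →
  ∀ (k : Type) [Field k] [NumberField k], IsImaginaryQuadratic k → NumberField.discr k = -4 →
  ∀ (i₀ : k), i₀ ^ 2 = -1 → ∀ (𝔭 : Ideal (𝓞 k)), 𝔭 ^ 2 = Ideal.span {(2 : 𝓞 k)} →
  ∀ (S : Brandt.XiSetup 1 N) [Fintype (Brandt.ClassSet S.O)] (φ : Brandt.ClassSet S.O → ℤ) (ψ : k →ₐ[ℚ] S.D)
    (I : Submodule ℤ S.D), Brandt.IsGrossPoint S.O ψ I →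
    φ ≠ 0 → Brandt.eigenLattice N (Brandt.matrix S.O) (fun p => W.frobeniusTrace p) = ℤ ∙ φ →
    ((2 : ℤ) ∣ edgeValue S.O φ I ∧ ¬ (4 : ℤ) ∣ edgeValue S.O φ I) →
  ∀ (J : ℕ → Submodule ℤ S.D), (∀ m ≥ 1, IsEdgeCMIdeal S.O ψ I 𝔭 m (J m)) → (∀ m ≥ 1, J (m + 1) ≤ J m) →
  ∀ n ≥ 5, ∀ (Sn Bn : ℤ[X]),
    IsSharpFlatPair (W.frobeniusTrace 2) n (edgeThetaPoly S.O φ ψ i₀ (n + 1) (J (n + 1))) (edgeThetaPoly S.O φ ψ i₀ n (J n)) Sn Bn →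
    (W.frobeniusTrace 2 = 2 →
      Sn.eval 1 = 0 ∧ (4 : ℤ) ∣ (Polynomial.derivative Sn).eval 1 ∧ ¬ (8 : ℤ) ∣ (Polynomial.derivative Sn).eval 1) ∧
    (W.frobeniusTrace 2 = -2 →
      (2 : ℤ) ∣ (Polynomial.derivative Sn).eval 1 ∧ ¬ (4 : ℤ) ∣ (Polynomial.derivative Sn).eval 1)

/-- **(C1′) `SharpLeadingTermRankOneUnit` — the UNIT-CLASS form of (C1) (REF1 §343 C′ / §349 R349a; support-grade, -an g33 v2).**
Same binders as (C1) plus the theta-internal hypothesis «`x₁ = Φ(g·J₂)` is ODD» (`edgeThetaCoeff … 2 (J 2) 1`; equivalently, by (Θ-genus-2)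
and `t₂ = 0`, «`L^alg(W^{(2)})·L^alg(W^{(-2)})` odd» — satisfied by 431 of the 447 rank-1 classes `N < 5·10⁵`, violated by the 16 REF1
witnesses).  Then `S_n(1) = 0 ∧ S_n'(1)` odd at every level.  NOT a law but a COROLLARY: `sharpLeadingTerm_of_levelTwo` (below, kernel-checked)
derives the conclusion for ALL `n ≥ 2` from the (Θ-3term) divisibilities, `θ₂(1) = t₂ = 0` and `x₁` odd — so C′ ⟸ `EdgeThreeTermRelation` ∧
(Θ-aug)/Gross (`t₂ = (a-2)(a+1)Φ(I)/2`, `Φ(I) = 0` in analytic rank 1).  DATA: 142/142 rows (census37 §B; all 20 archive curves have `x₁` odd).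
SOURCES: REF1-AUDIT §343, §349; Gross 1987 §11; AN-45 (Θ-aug); AN-47 (Θ-3term). -/
def SharpLeadingTermRankOneUnit : Prop :=
  ∀ (W : WeierstrassCurve ℚ) [W.IsElliptic] [W.IsGloballyMinimal] (N : ℕ),
    N.Prime → N % 4 = 3 → W.conductorNorm ℤ = N → (2 : ℤ) ∣ W.frobeniusTrace 2 → W.analyticRank = 1 →
  ∀ (W₁ : WeierstrassCurve ℚ) [W₁.IsElliptic] [W₁.IsGloballyMinimal] (C₁ : WeierstrassCurve.VariableChange ℚ),
    C₁ • W₁ = W.quadraticTwist (-1 : ℚ) → W₁.analyticRank = 1 →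
  ∀ (W₂ : WeierstrassCurve ℚ) [W₂.IsElliptic] [W₂.IsGloballyMinimal] (C₂ : WeierstrassCurve.VariableChange ℚ),
    C₂ • W₂ = W.quadraticTwist (2 : ℚ) → W₂.analyticRank = 0 →
  ∀ (W₃ : WeierstrassCurve ℚ) [W₃.IsElliptic] [W₃.IsGloballyMinimal] (C₃ : WeierstrassCurve.VariableChange ℚ),
    C₃ • W₃ = W.quadraticTwist (-2 : ℚ) → W₃.analyticRank = 0 →
  ∀ (k : Type) [Field k] [NumberField k], IsImaginaryQuadratic k → NumberField.discr k = -4 →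
  ∀ (i₀ : k), i₀ ^ 2 = -1 → ∀ (𝔭 : Ideal (𝓞 k)), 𝔭 ^ 2 = Ideal.span {(2 : 𝓞 k)} →
  ∀ (S : Brandt.XiSetup 1 N) [Fintype (Brandt.ClassSet S.O)] (φ : Brandt.ClassSet S.O → ℤ) (ψ : k →ₐ[ℚ] S.D)
    (I : Submodule ℤ S.D), Brandt.IsGrossPoint S.O ψ I →
    φ ≠ 0 → Brandt.eigenLattice N (Brandt.matrix S.O) (fun p => W.frobeniusTrace p) = ℤ ∙ φ →
  ∀ (J : ℕ → Submodule ℤ S.D), (∀ m ≥ 1, IsEdgeCMIdeal S.O ψ I 𝔭 m (J m)) → (∀ m ≥ 1, J (m + 1) ≤ J m) →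
    Odd (edgeThetaCoeff S.O φ ψ i₀ 2 (J 2) 1) →
  ∀ n ≥ 2, ∀ (Sn Bn : ℤ[X]),
    IsSharpFlatPair (W.frobeniusTrace 2) n (edgeThetaPoly S.O φ ψ i₀ (n + 1) (J (n + 1))) (edgeThetaPoly S.O φ ψ i₀ n (J n)) Sn Bn →
    Sn.eval 1 = 0 ∧ ¬ (2 : ℤ) ∣ (Polynomial.derivative Sn).eval 1

/-- **(C1″) `SharpLeadingTermRankOneMass` — the MASS form of (C1): `v₂(L♯_edge'(0)) = v₂(x₁) = ½·v₂(L^alg(W^{(2)})L^alg(W^{(-2)}))` EXACTLY, at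
every level (candidate, -an g33 v2 = REF1 §343 C″ in ♯-coordinates; beyond print).**  Binders of (C1); conclusion: for every `v`, if
`2^v ∥ x₁` (`x₁ = edgeThetaCoeff … 2 (J 2) 1`) then for all `n ≥ 2` and all ♯/♭ pairs `S_n(1) = 0` and `2^v ∥ S_n'(1)`.  For `v = 0` this is C′
(a corollary); by `sharp_eval_one_succ` only the PARITY of `S_n'(1)` is level-independent — the corrections `S_{n+1}'(1) - S_n'(1) =
-e_{n+1}(1)·((0,1)·A^{n-1})₁` are `≡ 0 (mod 2)` at the first step and `(mod 4)` afterwards (REF1 §349 `st_fst_four`), so for `v ≥ 2` the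
exact valuation is a GENUINE prediction: it says the three-term quotients `e_m(1)` carry enough 2-divisibility that the genus mass `x₁² =
L^alg(W₂)L^alg(W₋₂)` is the whole ♯ leading term (no extra 2-adic regulator/`Ш(W/ℚ(i))` factor beyond it).  DECIDED BY: D-an-36 (c) = edge theta
elements `θ_n`, `n ≤ 6`, of the 16 even-mass curves (54163a, …, 99251a [0,-1,1,-21662,-1219953] (`Ш_an(W₂) = 64`: `v = 4`? no — mass `64·4`:
`v = 4`), 227531a [0,1,1,-2,22] (`a₂ = -2`, smallest height), …): prediction `v₂(S_n'(1)) = v` for all `n`; ANY level with `v₂(S_n'(1)) ≠ v`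
kills C″ (and then the ♯ leading term sees more than the genus mass — itself informative).  WHY IT MIGHT FAIL: a Bertolini–Darmon-type leading
term would contain a 2-adic anticyclotomic regulator of `E(ℚ(i)) = E(ℚ) ⊕ E^{(-1)}(ℚ)` (rank 2) whose unit-ness is not implied by odd local
terms.  SOURCES: REF1-AUDIT §343 (R343d), §349; Bertolini–Darmon 1996 Conj. 4.4 (definite case) [doi:10.1007/s002220050105]; Sprung
[arXiv:1211.1352] Conj. 5.20. -/
def SharpLeadingTermRankOneMass : Prop :=
  ∀ (W : WeierstrassCurve ℚ) [W.IsElliptic] [W.IsGloballyMinimal] (N : ℕ),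
    N.Prime → N % 4 = 3 → W.conductorNorm ℤ = N → (2 : ℤ) ∣ W.frobeniusTrace 2 → W.analyticRank = 1 →
  ∀ (W₁ : WeierstrassCurve ℚ) [W₁.IsElliptic] [W₁.IsGloballyMinimal] (C₁ : WeierstrassCurve.VariableChange ℚ),
    C₁ • W₁ = W.quadraticTwist (-1 : ℚ) → W₁.analyticRank = 1 →
  ∀ (W₂ : WeierstrassCurve ℚ) [W₂.IsElliptic] [W₂.IsGloballyMinimal] (C₂ : WeierstrassCurve.VariableChange ℚ),
    C₂ • W₂ = W.quadraticTwist (2 : ℚ) → W₂.analyticRank = 0 →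
  ∀ (W₃ : WeierstrassCurve ℚ) [W₃.IsElliptic] [W₃.IsGloballyMinimal] (C₃ : WeierstrassCurve.VariableChange ℚ),
    C₃ • W₃ = W.quadraticTwist (-2 : ℚ) → W₃.analyticRank = 0 →
  ∀ (k : Type) [Field k] [NumberField k], IsImaginaryQuadratic k → NumberField.discr k = -4 →
  ∀ (i₀ : k), i₀ ^ 2 = -1 → ∀ (𝔭 : Ideal (𝓞 k)), 𝔭 ^ 2 = Ideal.span {(2 : 𝓞 k)} →
  ∀ (S : Brandt.XiSetup 1 N) [Fintype (Brandt.ClassSet S.O)] (φ : Brandt.ClassSet S.O → ℤ) (ψ : k →ₐ[ℚ] S.D)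
    (I : Submodule ℤ S.D), Brandt.IsGrossPoint S.O ψ I →
    φ ≠ 0 → Brandt.eigenLattice N (Brandt.matrix S.O) (fun p => W.frobeniusTrace p) = ℤ ∙ φ →
  ∀ (J : ℕ → Submodule ℤ S.D), (∀ m ≥ 1, IsEdgeCMIdeal S.O ψ I 𝔭 m (J m)) → (∀ m ≥ 1, J (m + 1) ≤ J m) →
  ∀ v : ℕ, (2 : ℤ) ^ v ∣ edgeThetaCoeff S.O φ ψ i₀ 2 (J 2) 1 → ¬ (2 : ℤ) ^ (v + 1) ∣ edgeThetaCoeff S.O φ ψ i₀ 2 (J 2) 1 →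
  ∀ n ≥ 2, ∀ (Sn Bn : ℤ[X]),
    IsSharpFlatPair (W.frobeniusTrace 2) n (edgeThetaPoly S.O φ ψ i₀ (n + 1) (J (n + 1))) (edgeThetaPoly S.O φ ψ i₀ n (J n)) Sn Bn →
    Sn.eval 1 = 0 ∧ (2 : ℤ) ^ v ∣ (Polynomial.derivative Sn).eval 1 ∧ ¬ (2 : ℤ) ^ (v + 1) ∣ (Polynomial.derivative Sn).eval 1

/-- **(G2)₋₂ `SharpRankZeroGenusLawMinusTwo` — the `a₂ = -2` half of (G2) from level `n = 2` on (REF1 §349 rider R349b; candidate).**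
Binders of (G2) with `a₂ = -2`; conclusion `2 ∥ S_n'(1)` for EVERY `n ≥ 2` (37/37 rows, 5 archive curves: 11a1, 1259c1, 1867a1, 2939a1,
3547c1).  ANATOMY (REF1 §349, engine 5/5): at `n = 2`, genus vanishing (`r_an(W^{(±2)}) = 1`) and `t₂ = (a-2)(a+1)t₀ = 4t₀` give `x₀ = x₁ = 2t₀`,
so `S_2'(1) = 2t₀` and `2 ∥` is just `t₀` odd; `S_3'(1) = 2t₀ - 2e₃(1)` and every later correction is `≡ 0 (mod 4)`, hence
**(G2)₋₂ ⟺ «`e₃(1)` is EVEN»**, `e₃ := (θ₄ - aθ₃ + F₃θ₂)/(X⁴ - 1)` the first three-term quotient (`4e₃(1) = P₄'(1) + 2P₃'(1) + 12t₀`):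
a parity law on the upper half of `θ₄`, not computed by any classical `L`-value.  WHY IT MIGHT FAIL: `e₃(1)` odd on a curve of this
pattern beyond `N = 7813` (REF1: the population `N < 7813` is 21 classes, all with unit 2-parts; D-an-36 (a)/(b)).  SOURCES: REF1-AUDIT §349;
census37 §C; Sprung [arXiv:1211.1352] Rem. 6.18 (Kurihara–Otsuki, `a₂ = ±2`). -/
def SharpRankZeroGenusLawMinusTwo : Prop :=
  ∀ (W : WeierstrassCurve ℚ) [W.IsElliptic] [W.IsGloballyMinimal] (N : ℕ),
    N.Prime → N % 4 = 3 → W.conductorNorm ℤ = N → W.frobeniusTrace 2 = -2 → W.analyticRank = 0 →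
  ∀ (W₁ : WeierstrassCurve ℚ) [W₁.IsElliptic] [W₁.IsGloballyMinimal] (C₁ : WeierstrassCurve.VariableChange ℚ),
    C₁ • W₁ = W.quadraticTwist (-1 : ℚ) → W₁.analyticRank = 0 →
  ∀ (W₂ : WeierstrassCurve ℚ) [W₂.IsElliptic] [W₂.IsGloballyMinimal] (C₂ : WeierstrassCurve.VariableChange ℚ),
    C₂ • W₂ = W.quadraticTwist (2 : ℚ) → W₂.analyticRank = 1 →
  ∀ (W₃ : WeierstrassCurve ℚ) [W₃.IsElliptic] [W₃.IsGloballyMinimal] (C₃ : WeierstrassCurve.VariableChange ℚ),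
    C₃ • W₃ = W.quadraticTwist (-2 : ℚ) → W₃.analyticRank = 1 →
  ∀ (k : Type) [Field k] [NumberField k], IsImaginaryQuadratic k → NumberField.discr k = -4 →
  ∀ (i₀ : k), i₀ ^ 2 = -1 → ∀ (𝔭 : Ideal (𝓞 k)), 𝔭 ^ 2 = Ideal.span {(2 : 𝓞 k)} →
  ∀ (S : Brandt.XiSetup 1 N) [Fintype (Brandt.ClassSet S.O)] (φ : Brandt.ClassSet S.O → ℤ) (ψ : k →ₐ[ℚ] S.D)
    (I : Submodule ℤ S.D), Brandt.IsGrossPoint S.O ψ I →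
    φ ≠ 0 → Brandt.eigenLattice N (Brandt.matrix S.O) (fun p => W.frobeniusTrace p) = ℤ ∙ φ →
    ((2 : ℤ) ∣ edgeValue S.O φ I ∧ ¬ (4 : ℤ) ∣ edgeValue S.O φ I) →
  ∀ (J : ℕ → Submodule ℤ S.D), (∀ m ≥ 1, IsEdgeCMIdeal S.O ψ I 𝔭 m (J m)) → (∀ m ≥ 1, J (m + 1) ≤ J m) →
  ∀ n ≥ 2, ∀ (Sn Bn : ℤ[X]),
    IsSharpFlatPair (W.frobeniusTrace 2) n (edgeThetaPoly S.O φ ψ i₀ (n + 1) (J (n + 1))) (edgeThetaPoly S.O φ ψ i₀ n (J n)) Sn Bn →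
    (2 : ℤ) ∣ (Polynomial.derivative Sn).eval 1 ∧ ¬ (4 : ℤ) ∣ (Polynomial.derivative Sn).eval 1

/-! ### The algebra of the ♯/♭ factorisation (kernel-checked): (S1) and (S2) from the three-term relation -/

/-- Sanity: the character factors at `m = 1, 2, 3`. -/
theorem edgeCharFactor_one : edgeCharFactor 1 = Polynomial.X - 1 := by simp [edgeCharFactor]
theorem edgeCharFactor_two : edgeCharFactor 2 = Polynomial.X + 1 := by simp [edgeCharFactor]
theorem edgeCharFactor_three : edgeCharFactor 3 = Polynomial.X ^ 2 + 1 := by simp [edgeCharFactor]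

@[simp] theorem adjChain_zero (a : ℤ) (uv : ℤ[X] × ℤ[X]) : adjChain a 0 uv = uv := rfl
@[simp] theorem adjChain_one (a : ℤ) (uv : ℤ[X] × ℤ[X]) : adjChain a 1 uv = uv := rfl
theorem adjChain_succ_succ (a : ℤ) (n : ℕ) (uv : ℤ[X] × ℤ[X]) :
    adjChain a (n + 1 + 1) uv = adjChain a (n + 1) (sharpFlatStep a (n + 1 + 1) uv) := rfl

/-- `D_2 = F_2 = X + 1`. -/
theorem sharpFlatDenominator_two : sharpFlatDenominator 2 = edgeCharFactor 2 := by
  simp [sharpFlatDenominator]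

/-- `D_{n+1} = D_n · F_{n+1}` (`n ≥ 1`). -/
theorem sharpFlatDenominator_succ (n : ℕ) (hn : 2 ≤ n + 1) :
    sharpFlatDenominator (n + 1) = sharpFlatDenominator n * edgeCharFactor (n + 1) := by
  unfold sharpFlatDenominator
  rw [Finset.prod_Icc_succ_top hn]

/-- `(X - 1)·D_n = X^{2^{n-1}} - 1 = ω_n` (`n ≥ 1`): the denominator is the full trivial-zero product bar the trivial character. -/
theorem sharpFlatDenominator_mul (n : ℕ) (hn : 1 ≤ n) :
    (Polynomial.X - 1) * sharpFlatDenominator n = Polynomial.X ^ (2 ^ (n - 1)) - 1 := by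
  induction n, hn using Nat.le_induction with
  | base =>
    unfold sharpFlatDenominator
    rw [Finset.Icc_eq_empty (by norm_num), Finset.prod_empty]
    norm_num
  | succ n hn ih =>
    rw [sharpFlatDenominator_succ n (by omega), ← mul_assoc, ih]
    obtain ⟨j, rfl⟩ : ∃ j, n = j + 1 := ⟨n - 1, by omega⟩
    have e1 : j + 1 + 1 - 2 = j := by omega
    have e2 : j + 1 - 1 = j := by omega
    have e3 : j + 1 + 1 - 1 = j + 1 := by omega
    unfold edgeCharFactor
    rw [if_neg (by omega), e1, e2, e3, pow_succ, pow_mul]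
    ring

/-- One adjugate step is `ℤ[X]`-linear. -/
theorem sharpFlatStep_lin (a : ℤ) (m : ℕ) (c u v u' v' : ℤ[X]) :
    sharpFlatStep a m (c * u + u', c * v + v') =
      (c * (sharpFlatStep a m (u, v)).1 + (sharpFlatStep a m (u', v')).1,
       c * (sharpFlatStep a m (u, v)).2 + (sharpFlatStep a m (u', v')).2) := by
  simp only [sharpFlatStep, Prod.mk.injEq]
  constructor <;> ring

theorem sharpFlatStep_zero (a : ℤ) (m : ℕ) : sharpFlatStep a m (0, 0) = (0, 0) := by
  simp [sharpFlatStep]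

/-- The adjugate chain is `ℤ[X]`-linear. -/
theorem adjChain_lin (a : ℤ) (n : ℕ) : ∀ (c u v u' v' : ℤ[X]),
    adjChain a n (c * u + u', c * v + v') =
      (c * (adjChain a n (u, v)).1 + (adjChain a n (u', v')).1,
       c * (adjChain a n (u, v)).2 + (adjChain a n (u', v')).2) := by
  induction n with
  | zero => intros; simp
  | succ m ih =>
    cases m with
    | zero => intros; simp
    | succ m' =>
      intro c u v u' v'
      rw [adjChain_succ_succ, adjChain_succ_succ, adjChain_succ_succ, sharpFlatStep_lin]
      exact ih c _ _ _ _

theorem adjChain_zero_zero (a : ℤ) (n : ℕ) : adjChain a n (0, 0) = (0, 0) := by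
  induction n with
  | zero => rfl
  | succ m ih =>
    cases m with
    | zero => rfl
    | succ m' => rw [adjChain_succ_succ, sharpFlatStep_zero]; exact ih

theorem adjChain_smul (a : ℤ) (n : ℕ) (c u v : ℤ[X]) :
    adjChain a n (c * u, c * v) = (c * (adjChain a n (u, v)).1, c * (adjChain a n (u, v)).2) := by
  have h := adjChain_lin a n c u v 0 0
  simpa [adjChain_zero_zero] using h

/-- **THE ♯/♭ DIVISIBILITY THEOREM (algebraic core of (S1), -an g33 §36).**  If a sequence `P : ℕ → ℤ[X]` satisfies the three-term relation
`(X-1)·D_m ∣ P_{m+1} - a·P_m + F_m·P_{m-1}` for all `m ≥ 2` (`(X-1)·D_m = X^{2^{m-1}} - 1`, `sharpFlatDenominator_mul`), then for every `n ≥ 2`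
the ♯/♭ pair exists: `(P_{n+1}, P_n)·adj(𝒞_2⋯𝒞_n) ∈ D_n·(ℤ[X] × ℤ[X])`.  Proof: `(P_{n+1}, P_n)·adj 𝒞_n = F_n·(P_n, P_{n-1}) - (0, (X-1)D_n e_n)`,
linearity of the chain, induction. -/
theorem sharpFlatPair_of_threeTerm (a : ℤ) (P : ℕ → ℤ[X])
    (hP : ∀ m, 2 ≤ m → (Polynomial.X - 1) * sharpFlatDenominator m ∣
      P (m + 1) - Polynomial.C a * P m + edgeCharFactor m * P (m - 1)) :
    ∀ n, 2 ≤ n → ∃ Sn Bn : ℤ[X], IsSharpFlatPair a n (P (n + 1)) (P n) Sn Bn := by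
  intro n hn
  induction n, hn using Nat.le_induction with
  | base =>
    obtain ⟨q, hq⟩ := hP 2 le_rfl
    simp only [Nat.reduceAdd, Nat.reduceSub, sharpFlatDenominator_two] at hq
    refine ⟨P 2, P 1 - (Polynomial.X - 1) * q, ?_⟩
    unfold IsSharpFlatPair
    have h2 : adjChain a 2 (P (2 + 1), P 2) = sharpFlatStep a 2 (P 3, P 2) := rfl
    rw [h2, sharpFlatDenominator_two]
    simp only [sharpFlatStep, Prod.mk.injEq]
    exact ⟨by ring, by linear_combination (-1 : ℤ[X]) * hq⟩
  | succ n hn ih =>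
    obtain ⟨Sn, Bn, hSB⟩ := ih
    obtain ⟨j, rfl⟩ : ∃ j, n = j + 1 := ⟨n - 1, by omega⟩
    obtain ⟨q, hq⟩ := hP (j + 1 + 1) (by omega)
    simp only [Nat.add_sub_cancel] at hq
    unfold IsSharpFlatPair at hSB ⊢
    refine ⟨Sn - (Polynomial.X - 1) * q * (adjChain a (j + 1) (0, 1)).1,
      Bn - (Polynomial.X - 1) * q * (adjChain a (j + 1) (0, 1)).2, ?_⟩
    have hstep : sharpFlatStep a (j + 1 + 1) (P (j + 1 + 1 + 1), P (j + 1 + 1)) =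
        (edgeCharFactor (j + 1 + 1) * P (j + 1 + 1) + 0,
         edgeCharFactor (j + 1 + 1) * P (j + 1) + -((Polynomial.X - 1) * sharpFlatDenominator (j + 1 + 1) * q)) := by
      simp only [sharpFlatStep, Prod.mk.injEq]
      exact ⟨by ring, by linear_combination (-1 : ℤ[X]) * hq⟩
    have h0 := adjChain_smul a (j + 1) (-((Polynomial.X - 1) * sharpFlatDenominator (j + 1 + 1) * q)) 0 1
    simp only [mul_zero, mul_one] at h0
    rw [adjChain_succ_succ, hstep, adjChain_lin, hSB, h0, sharpFlatDenominator_succ (j + 1) (by omega)]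
    simp only [Prod.mk.injEq]
    constructor <;> ring

/-- **(S1) in the `X^{2^{m-1}} - 1` form of `EdgeThreeTermRelation` (AN-47).**  With `hP` literally the conclusion of (Θ-3term) for the
polynomials `P_m` of a nested chain, the ♯/♭ pair exists at every level `n ≥ 2` — so `SharpFlatDivisibility ⟸ EdgeThreeTermRelation`
(modulo identifying the verbatim copies of `edgeThetaPoly`/`edgeCharFactor` in the two namespaces). -/
theorem sharpFlatPair_of_threeTerm' (a : ℤ) (P : ℕ → ℤ[X])
    (hP : ∀ m, 2 ≤ m → (Polynomial.X ^ (2 ^ (m - 1)) - 1 : ℤ[X]) ∣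
      P (m + 1) - Polynomial.C a * P m + edgeCharFactor m * P (m - 1)) :
    ∀ n, 2 ≤ n → ∃ Sn Bn : ℤ[X], IsSharpFlatPair a n (P (n + 1)) (P n) Sn Bn := by
  refine sharpFlatPair_of_threeTerm a P (fun m hm => ?_)
  rw [sharpFlatDenominator_mul m (by omega)]
  exact hP m hm

/-- **(S2) algebraic core: uniqueness + the compatibility shape.**  ♯/♭ pairs are unique (`ℤ[X]` is a domain and `D_n ≠ 0`). -/
theorem sharpFlatDenominator_ne_zero (n : ℕ) : sharpFlatDenominator n ≠ 0 := by
  unfold sharpFlatDenominator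
  rw [Finset.prod_ne_zero_iff]
  intro m hm
  unfold edgeCharFactor
  split_ifs with h
  · exact Polynomial.X_sub_C_ne_zero 1
  · exact Polynomial.Monic.ne_zero (Polynomial.monic_X_pow_add_C _ (by positivity))

theorem isSharpFlatPair_unique (a : ℤ) (n : ℕ) (P' P S B S' B' : ℤ[X])
    (h : IsSharpFlatPair a n P' P S B) (h' : IsSharpFlatPair a n P' P S' B') : S = S' ∧ B = B' := by
  unfold IsSharpFlatPair at h h'
  rw [h, Prod.mk.injEq] at h'
  exact ⟨mul_left_cancel₀ (sharpFlatDenominator_ne_zero n) h'.1, mul_left_cancel₀ (sharpFlatDenominator_ne_zero n) h'.2⟩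

/-! ### (C1) anatomy (REF1 §349 (ii), kernel-checked here, -an g33 v2): `S_2 = θ_2`, and the value `S_n(1)` and the PARITY of
`S_n'(1)` are LEVEL-INDEPENDENT consequences of the three-term relation — so (C1)/(C1′) live entirely at level 2 -/

/-- Any level-`2` ♯ component IS `P_2 = θ_2` (`(P_2·F_2, -P_3 + a·P_2) = (F_2·S, F_2·B)` and `F_2 ≠ 0`). -/
theorem sharp_two_eq (a : ℤ) (P' P S B : ℤ[X]) (h : IsSharpFlatPair a 2 P' P S B) : S = P := by
  unfold IsSharpFlatPair at h
  have h2 : adjChain a 2 (P', P) = sharpFlatStep a 2 (P', P) := rfl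
  rw [h2, sharpFlatDenominator_two] at h
  simp only [sharpFlatStep, Prod.mk.injEq] at h
  have hF : edgeCharFactor 2 ≠ 0 := by rw [← sharpFlatDenominator_two]; exact sharpFlatDenominator_ne_zero 2
  have h1 : edgeCharFactor 2 * P = edgeCharFactor 2 * S := by rw [mul_comm]; exact h.1
  exact (mul_left_cancel₀ hF h1).symm

/-- `F_2(1) = 2`. -/
theorem edgeCharFactor_two_eval_one : (edgeCharFactor 2).eval 1 = 2 := by
  rw [edgeCharFactor_two]; simp

/-- After at least one adjugate step the FIRST component is a multiple of `F_2 = X + 1` (the innermost step multiplies by `F_2`);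
hence its value at `X = 1` is even. -/
theorem adjChain_fst_dvd (a : ℤ) : ∀ n, 2 ≤ n → ∀ uv : ℤ[X] × ℤ[X], edgeCharFactor 2 ∣ (adjChain a n uv).1 := by
  intro n hn
  induction n, hn using Nat.le_induction with
  | base =>
    intro uv
    have h2 : adjChain a 2 uv = sharpFlatStep a 2 uv := rfl
    rw [h2]
    exact ⟨uv.2, by simp [sharpFlatStep, mul_comm]⟩
  | succ n hn ih =>
    intro uv
    obtain ⟨j, rfl⟩ : ∃ j, n = j + 1 := ⟨n - 1, by omega⟩
    rw [adjChain_succ_succ]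
    exact ih _

/-- THE SUCCESSOR PAIR, explicitly (the succ-step of `sharpFlatPair_of_threeTerm`, isolated): from a pair `(S, B)` at level `n ≥ 2` and the
three-term quotient `q = e_{n+1}` one gets the pair `(S, B) - (X-1)·q·adjChain a n (0, 1)` at level `n+1`. -/
theorem sharpFlat_succ_of_threeTerm (a : ℤ) (P : ℕ → ℤ[X]) (n : ℕ) (hn : 2 ≤ n) (S B q : ℤ[X])
    (hSB : IsSharpFlatPair a n (P (n + 1)) (P n) S B)
    (hq : P (n + 1 + 1) - Polynomial.C a * P (n + 1) + edgeCharFactor (n + 1) * P n =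
      (Polynomial.X - 1) * sharpFlatDenominator (n + 1) * q) :
    IsSharpFlatPair a (n + 1) (P (n + 1 + 1)) (P (n + 1))
      (S - (Polynomial.X - 1) * q * (adjChain a n (0, 1)).1)
      (B - (Polynomial.X - 1) * q * (adjChain a n (0, 1)).2) := by
  obtain ⟨j, rfl⟩ : ∃ j, n = j + 1 := ⟨n - 1, by omega⟩
  unfold IsSharpFlatPair at hSB ⊢
  have hstep : sharpFlatStep a (j + 1 + 1) (P (j + 1 + 1 + 1), P (j + 1 + 1)) =
      (edgeCharFactor (j + 1 + 1) * P (j + 1 + 1) + 0,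
       edgeCharFactor (j + 1 + 1) * P (j + 1) + -((Polynomial.X - 1) * sharpFlatDenominator (j + 1 + 1) * q)) := by
    simp only [sharpFlatStep, Prod.mk.injEq]
    exact ⟨by ring, by linear_combination (-1 : ℤ[X]) * hq⟩
  have h0 := adjChain_smul a (j + 1) (-((Polynomial.X - 1) * sharpFlatDenominator (j + 1 + 1) * q)) 0 1
  simp only [mul_zero, mul_one] at h0
  rw [adjChain_succ_succ, hstep, adjChain_lin, hSB, h0, sharpFlatDenominator_succ (j + 1) (by omega)]
  simp only [Prod.mk.injEq]
  constructor <;> ring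

/-- **LEVEL-INDEPENDENCE (REF1 §349 (ii)).**  Under the three-term divisibilities, consecutive ♯ components have the SAME value at `X = 1`
and derivatives at `X = 1` of the SAME PARITY — for every `a` (the correction is `(X-1)·q·w` with `F_2 ∣ w`, so its derivative at `1` is
`q(1)·w(1) ∈ 2ℤ`). -/
theorem sharp_eval_one_succ (a : ℤ) (P : ℕ → ℤ[X])
    (hP : ∀ m, 2 ≤ m → (Polynomial.X - 1) * sharpFlatDenominator m ∣
      P (m + 1) - Polynomial.C a * P m + edgeCharFactor m * P (m - 1))
    (n : ℕ) (hn : 2 ≤ n) (S B S' B' : ℤ[X])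
    (hSB : IsSharpFlatPair a n (P (n + 1)) (P n) S B)
    (hSB' : IsSharpFlatPair a (n + 1) (P (n + 1 + 1)) (P (n + 1)) S' B') :
    S'.eval 1 = S.eval 1 ∧
      (2 : ℤ) ∣ (Polynomial.derivative S').eval 1 - (Polynomial.derivative S).eval 1 := by
  obtain ⟨q, hq⟩ := hP (n + 1) (by omega)
  simp only [Nat.add_sub_cancel] at hq
  have h2 := sharpFlat_succ_of_threeTerm a P n hn S B q hSB hq
  obtain ⟨hS, -⟩ := isSharpFlatPair_unique a (n + 1) _ _ _ _ _ _ hSB' h2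
  obtain ⟨w, hw⟩ := adjChain_fst_dvd a n hn (0, 1)
  rw [hS, hw]
  refine ⟨by simp [Polynomial.eval_sub, Polynomial.eval_mul], ?_⟩
  have hd : (Polynomial.derivative (S - (Polynomial.X - 1) * q * (edgeCharFactor 2 * w))).eval 1 =
      (Polynomial.derivative S).eval 1 - 2 * (q.eval 1 * w.eval 1) := by
    simp only [Polynomial.derivative_sub, Polynomial.derivative_mul, Polynomial.derivative_X, Polynomial.derivative_one,
      Polynomial.eval_sub, Polynomial.eval_mul, Polynomial.eval_add, Polynomial.eval_X, Polynomial.eval_one,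
      Polynomial.eval_zero, edgeCharFactor_two_eval_one]
    ring
  rw [hd]
  exact ⟨-(q.eval 1 * w.eval 1), by ring⟩

/-- **C′ IS A COROLLARY (REF1 §343/§349), kernel-checked: the unit-class leading term at EVERY level from level 2.**  If the `P_m` satisfy the
three-term divisibilities, `P_2(1) = 0` (`= t₂`, Gross: analytic rank ≥ 1) and `P_2'(1) = x₁` is odd («mass odd»), then every ♯ component at
every level `n ≥ 2` has `S_n(1) = 0` and `S_n'(1)` odd — i.e. `SharpLeadingTermRankOneUnit ⟸ EdgeThreeTermRelation ∧ (t₂ = 0)`, and (C1) itself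
holds for exactly the curves with `x₁` odd. -/
theorem sharpLeadingTerm_of_levelTwo (a : ℤ) (P : ℕ → ℤ[X])
    (hP : ∀ m, 2 ≤ m → (Polynomial.X - 1) * sharpFlatDenominator m ∣
      P (m + 1) - Polynomial.C a * P m + edgeCharFactor m * P (m - 1))
    (h0 : (P 2).eval 1 = 0) (h1 : ¬ (2 : ℤ) ∣ (Polynomial.derivative (P 2)).eval 1) :
    ∀ n, 2 ≤ n → ∀ S B : ℤ[X], IsSharpFlatPair a n (P (n + 1)) (P n) S B →
      S.eval 1 = 0 ∧ ¬ (2 : ℤ) ∣ (Polynomial.derivative S).eval 1 := by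
  intro n hn
  induction n, hn using Nat.le_induction with
  | base =>
    intro S B hSB
    rw [sharp_two_eq a _ _ _ _ hSB]
    exact ⟨h0, h1⟩
  | succ n hn ih =>
    intro S' B' hSB'
    obtain ⟨S, B, hSB⟩ := sharpFlatPair_of_threeTerm a P hP n hn
    obtain ⟨hv, hd⟩ := sharp_eval_one_succ a P hP n hn S B S' B' hSB hSB'
    obtain ⟨h0n, h1n⟩ := ih S B hSB
    refine ⟨by rw [hv, h0n], fun h2 => h1n ?_⟩
    have h3 := dvd_sub h2 hd
    rwa [sub_sub_cancel] at h3

/-- The same in the `X^{2^{m-1}} - 1` form of (Θ-3term) (AN-47 `EdgeThreeTermRelation`). -/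
theorem sharpLeadingTerm_of_levelTwo' (a : ℤ) (P : ℕ → ℤ[X])
    (hP : ∀ m, 2 ≤ m → (Polynomial.X ^ (2 ^ (m - 1)) - 1 : ℤ[X]) ∣
      P (m + 1) - Polynomial.C a * P m + edgeCharFactor m * P (m - 1))
    (h0 : (P 2).eval 1 = 0) (h1 : ¬ (2 : ℤ) ∣ (Polynomial.derivative (P 2)).eval 1) :
    ∀ n, 2 ≤ n → ∀ S B : ℤ[X], IsSharpFlatPair a n (P (n + 1)) (P n) S B →
      S.eval 1 = 0 ∧ ¬ (2 : ℤ) ∣ (Polynomial.derivative S).eval 1 :=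
  sharpLeadingTerm_of_levelTwo a P (fun m hm => by rw [sharpFlatDenominator_mul m (by omega)]; exact hP m hm) h0 h1

/-! ### (S4) MOD 2 THE ♯/♭ PAIR IS THE ± PAIR (kernel-checked, -an g33 v3): for `a` even, `θ_L ≡ S·ω̃_L` (`L` even) and
`θ_L ≡ B·ω̃_L` (`L` odd) modulo `2ℤ[X]`, `ω̃_L = ∏_{2 ≤ m < L, m ≢ L (2)} F_m` the signed trivial factor of AN-47 — hence (with `μ = 0`)
`λ(θ_L) = λ♯ + deg ω̃_L` at even levels and `λ(θ_L) = λ♭ + deg ω̃_L` at odd levels: the EVEN levels of the edge tower see `L♯`, the ODD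
levels see `L♭`, although `a₂ = ±2 ≠ 0` (census: `λ(θ_n) = λ(S_n) + Σ_{k odd, 3≤k≤n-1} 2^{k-2}` (`n` even) / `λ(B_n) + Σ_{k even, 2≤k≤n-1} 2^{k-2}`
(`n` odd) on 148/148 top-level rows of the 74 `a₂`-even archive curves, tab36_out.json ce160dd3002e8c96; e.g. 11a1: `λ(θ_8) = 45 = 3 + 42`,
`λ(θ_9) = 85 = 0 + 85`). -/

/-- `Π_n := ∏_{2 ≤ m ≤ n, m ≡ n (mod 2)} F_m` (`Π_0 = Π_1 = 1`, `Π_{n+2} = Π_n·F_{n+2}`): AN-47's `ω̃_L = Π_{L-1}`, and `D_n = Π_n·Π_{n-1}`. -/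
noncomputable def parityProd : ℕ → ℤ[X]
  | 0 => 1
  | 1 => 1
  | (n + 2) => parityProd n * edgeCharFactor (n + 2)

@[simp] theorem parityProd_zero : parityProd 0 = 1 := rfl
@[simp] theorem parityProd_one : parityProd 1 = 1 := rfl
theorem parityProd_succ_succ (n : ℕ) : parityProd (n + 2) = parityProd n * edgeCharFactor (n + 2) := rfl
theorem parityProd_two : parityProd 2 = edgeCharFactor 2 := by
  show parityProd 0 * edgeCharFactor 2 = _
  rw [parityProd_zero, one_mul]

/-- `D_n = Π_n · Π_{n-1}` (`n ≥ 1`). -/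
theorem sharpFlatDenominator_eq_parityProd : ∀ n, 1 ≤ n → sharpFlatDenominator n = parityProd n * parityProd (n - 1) := by
  intro n hn
  induction n, hn using Nat.le_induction with
  | base => simp [sharpFlatDenominator]
  | succ n hn ih =>
    obtain ⟨j, rfl⟩ : ∃ j, n = j + 1 := ⟨n - 1, by omega⟩
    rw [sharpFlatDenominator_succ (j + 1) (by omega), ih, show j + 1 + 1 = j + 2 from rfl, parityProd_succ_succ,
      show j + 2 - 1 = j + 1 from rfl, show j + 1 - 1 = j from rfl]
    ring

/-- `F_m` is monic for `m ≥ 2`. -/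
theorem edgeCharFactor_monic (m : ℕ) (hm : 2 ≤ m) : (edgeCharFactor m).Monic := by
  unfold edgeCharFactor
  rw [if_neg (by omega)]
  simpa using Polynomial.monic_X_pow_add_C (1 : ℤ) (pow_ne_zero (m - 2) two_ne_zero)

/-- `Π_n` is monic. -/
theorem parityProd_monic : ∀ n, (parityProd n).Monic ∧ (parityProd (n + 1)).Monic := by
  intro n
  induction n with
  | zero => exact ⟨Polynomial.monic_one, Polynomial.monic_one⟩
  | succ n ih =>
    refine ⟨ih.2, ?_⟩
    rw [show n + 1 + 1 = n + 2 from rfl, parityProd_succ_succ]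
    exact ih.1.mul (edgeCharFactor_monic (n + 2) (by omega))

/-- `2` is prime in `ℤ[X]`. -/
theorem prime_two_poly : Prime (2 : ℤ[X]) := by
  have h := (Polynomial.prime_C_iff (r := (2 : ℤ))).mpr Int.prime_two
  simpa using h

/-- A monic integer polynomial is not divisible by `2`. -/
theorem not_two_dvd_of_monic (p : ℤ[X]) (hp : p.Monic) : ¬ (2 : ℤ[X]) ∣ p := by
  rintro ⟨g, hg⟩
  have hl := congr_arg Polynomial.leadingCoeff hg
  rw [hp.leadingCoeff, show (2 : ℤ[X]) = Polynomial.C 2 by simp, Polynomial.leadingCoeff_mul,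
    Polynomial.leadingCoeff_C] at hl
  omega

theorem not_two_dvd_parityProd (n : ℕ) : ¬ (2 : ℤ[X]) ∣ parityProd n :=
  not_two_dvd_of_monic _ (parityProd_monic n).1

/-- THE MOD-2 SHAPE OF THE ADJUGATE CHAIN for `a` even: `adjChain a n (u, v) ≡ (v·Π_n, u·Π_{n-1})` (`n` even), `≡ (u·Π_{n-1}, v·Π_n)`
(`n` odd) modulo `2` — one step is `(u, v) ↦ (v·F_m, -u + a·v) ≡ (v·F_m, u)`. -/
theorem adjChain_mod_two (a : ℤ) (ha : (2 : ℤ) ∣ a) : ∀ n, 2 ≤ n → ∀ u v : ℤ[X],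
    (Even n → ∃ G H : ℤ[X], adjChain a n (u, v) = (v * parityProd n + 2 * G, u * parityProd (n - 1) + 2 * H)) ∧
    (Odd n → ∃ G H : ℤ[X], adjChain a n (u, v) = (u * parityProd (n - 1) + 2 * G, v * parityProd n + 2 * H)) := by
  obtain ⟨b, rfl⟩ := ha
  have hC : Polynomial.C (2 * b : ℤ) = 2 * Polynomial.C b := by simp
  intro n hn
  induction n, hn using Nat.le_induction with
  | base =>
    intro u v
    refine ⟨fun _ => ⟨0, Polynomial.C b * v - u, ?_⟩, fun h => absurd h (by decide)⟩
    have h2 : adjChain (2 * b) 2 (u, v) = sharpFlatStep (2 * b) 2 (u, v) := rfl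
    rw [h2, show (2 : ℕ) - 1 = 1 from rfl, parityProd_one, parityProd_two]
    simp only [sharpFlatStep, Prod.mk.injEq, hC]
    constructor <;> ring
  | succ n hn ih =>
    intro u v
    obtain ⟨j, rfl⟩ : ∃ j, n = j + 1 := ⟨n - 1, by omega⟩
    rw [adjChain_succ_succ]
    have ih' := ih (v * edgeCharFactor (j + 1 + 1)) (-u + Polynomial.C (2 * b) * v)
    have hstep : sharpFlatStep (2 * b) (j + 1 + 1) (u, v) = (v * edgeCharFactor (j + 1 + 1), -u + Polynomial.C (2 * b) * v) := rfl
    rw [hstep]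
    constructor
    · intro hev
      have hodd : Odd (j + 1) := by rcases hev with ⟨r, hr⟩; exact ⟨r - 1, by omega⟩
      obtain ⟨G, H, hGH⟩ := ih'.2 hodd
      refine ⟨G, H + Polynomial.C b * v * parityProd (j + 1) - u * parityProd (j + 1), ?_⟩
      rw [hGH, show j + 1 + 1 = j + 2 from rfl, parityProd_succ_succ, show j + 2 - 1 = j + 1 from rfl,
        show j + 1 - 1 = j from rfl, hC]
      simp only [Prod.mk.injEq]
      constructor <;> ring
    · intro hod
      have hev : Even (j + 1) := by rcases hod with ⟨s, hs⟩; exact ⟨s, by omega⟩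
      obtain ⟨G, H, hGH⟩ := ih'.1 hev
      refine ⟨G + Polynomial.C b * v * parityProd (j + 1) - u * parityProd (j + 1), H, ?_⟩
      rw [hGH, show j + 1 + 1 = j + 2 from rfl, parityProd_succ_succ, show j + 2 - 1 = j + 1 from rfl,
        show j + 1 - 1 = j from rfl, hC]
      simp only [Prod.mk.injEq]
      constructor <;> ring

/-- **(S4) MOD 2, ♯/♭ = ± (kernel-checked).**  For `a` even and any ♯/♭ pair `(S, B)` of `(P', P) = (θ_{n+1}, θ_n)` at level `n ≥ 2`:
`θ_n ≡ S·Π_{n-1}`, `θ_{n+1} ≡ B·Π_n` (`n` even) resp. `θ_n ≡ B·Π_{n-1}`, `θ_{n+1} ≡ S·Π_n` (`n` odd) modulo `2ℤ[X]` — i.e.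
`θ_L ≡ (S if L even, B if L odd)·ω̃_L`.  Proof: `adjChain_mod_two` + `D_n = Π_nΠ_{n-1}` + cancellation of the monic `Π`'s against the
prime `2` of `ℤ[X]`.  Consequence (`μ = 0`, V12): `λ(θ_L) = λ(S) + deg ω̃_L` (`L` even), `= λ(B) + deg ω̃_L` (`L` odd): 148/148 rows. -/
theorem sharpFlat_mod_two (a : ℤ) (ha : (2 : ℤ) ∣ a) (n : ℕ) (hn : 2 ≤ n) (P' P S B : ℤ[X])
    (h : IsSharpFlatPair a n P' P S B) :
    (Even n → (2 : ℤ[X]) ∣ P - S * parityProd (n - 1) ∧ (2 : ℤ[X]) ∣ P' - B * parityProd n) ∧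
    (Odd n → (2 : ℤ[X]) ∣ P - B * parityProd (n - 1) ∧ (2 : ℤ[X]) ∣ P' - S * parityProd n) := by
  have hD := sharpFlatDenominator_eq_parityProd n (by omega)
  unfold IsSharpFlatPair at h
  rw [hD] at h
  constructor
  · intro hev
    obtain ⟨G, H, hGH⟩ := (adjChain_mod_two a ha n hn P' P).1 hev
    rw [h, Prod.mk.injEq] at hGH
    constructor
    · have h1 : (2 : ℤ[X]) ∣ parityProd n * (P - S * parityProd (n - 1)) :=
        ⟨-G, by linear_combination (-1 : ℤ[X]) * hGH.1⟩
      exact (prime_two_poly.dvd_or_dvd h1).resolve_left (not_two_dvd_parityProd n)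
    · have h2 : (2 : ℤ[X]) ∣ parityProd (n - 1) * (P' - B * parityProd n) :=
        ⟨-H, by linear_combination (-1 : ℤ[X]) * hGH.2⟩
      exact (prime_two_poly.dvd_or_dvd h2).resolve_left (not_two_dvd_parityProd (n - 1))
  · intro hod
    obtain ⟨G, H, hGH⟩ := (adjChain_mod_two a ha n hn P' P).2 hod
    rw [h, Prod.mk.injEq] at hGH
    constructor
    · have h1 : (2 : ℤ[X]) ∣ parityProd n * (P - B * parityProd (n - 1)) :=
        ⟨-H, by linear_combination (-1 : ℤ[X]) * hGH.2⟩
      exact (prime_two_poly.dvd_or_dvd h1).resolve_left (not_two_dvd_parityProd n)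
    · have h2 : (2 : ℤ[X]) ∣ parityProd (n - 1) * (P' - S * parityProd n) :=
        ⟨-G, by linear_combination (-1 : ℤ[X]) * hGH.1⟩
      exact (prime_two_poly.dvd_or_dvd h2).resolve_left (not_two_dvd_parityProd (n - 1))

/-! ### (S4λ) THE λ-SHIFT LAW (kernel-checked, -an g33 v4): the `T`-adic (`T = X - 1`) coefficients of `θ_L` modulo `2` are those
of `S` (even `L`) resp. `B` (odd `L`) SHIFTED by `deg ω̃_L`; hence `λ(θ_L) = λ♯ + deg ω̃_L` / `λ♭ + deg ω̃_L` in the `μ = 0` encoding of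
V12 `EdgeThetaLambdaParity` («the first odd `T`-coefficient»).  Ingredients: `(X+1)^{2^j} + 1 ≡ X^{2^j}` in `𝔽₂[X]` (Frobenius). -/

/-- `q_n := deg Π_n = Σ_{2 ≤ m ≤ n, m ≡ n (2)} 2^{m-2}` (`q_0 = q_1 = 0`, `q_{n+2} = q_n + 2^n`); `deg ω̃_L = q_{L-1}`:
`q_2, q_3, … = 1, 2, 5, 10, 21, 42, 85, 170, 341, …`. -/
def parityDeg : ℕ → ℕ
  | 0 => 0
  | 1 => 0
  | (n + 2) => parityDeg n + 2 ^ n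

@[simp] theorem parityDeg_zero : parityDeg 0 = 0 := rfl
@[simp] theorem parityDeg_one : parityDeg 1 = 0 := rfl
theorem parityDeg_succ_succ (n : ℕ) : parityDeg (n + 2) = parityDeg n + 2 ^ n := rfl
example : parityDeg 7 = 42 ∧ parityDeg 8 = 85 ∧ parityDeg 9 = 170 := by decide

/-- Reduction modulo `2` of integer polynomials. -/
noncomputable def modTwo : ℤ[X] →+* (ZMod 2)[X] := Polynomial.mapRingHom (Int.castRingHom (ZMod 2))

theorem modTwo_apply (f : ℤ[X]) : modTwo f = Polynomial.map (Int.castRingHom (ZMod 2)) f := rfl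

theorem modTwo_two : modTwo (2 : ℤ[X]) = 0 := by
  rw [modTwo_apply, show (2 : ℤ[X]) = Polynomial.C 2 by simp, Polynomial.map_C]
  have h2 : (Int.castRingHom (ZMod 2)) 2 = 0 := by decide
  rw [h2, map_zero]

theorem modTwo_eq_of_two_dvd {f g : ℤ[X]} (h : (2 : ℤ[X]) ∣ f - g) : modTwo f = modTwo g := by
  obtain ⟨e, he⟩ := h
  have hf : f = g + 2 * e := by rw [← he]; ring
  rw [hf, map_add, map_mul, modTwo_two, zero_mul, add_zero]

/-- `modTwo` commutes with the Taylor shift `T = X - 1`. -/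
theorem modTwo_taylor (f : ℤ[X]) : modTwo (Polynomial.taylor 1 f) = Polynomial.taylor 1 (modTwo f) := by
  rw [modTwo_apply, modTwo_apply, Polynomial.taylor_apply, Polynomial.taylor_apply, Polynomial.map_comp]
  simp [Polynomial.map_add, Polynomial.map_X]

/-- Frobenius: `F_m(T+1) = (T+1)^{2^{m-2}} + 1 ≡ T^{2^{m-2}} (mod 2)` for `m ≥ 2`. -/
theorem modTwo_taylor_edgeCharFactor (m : ℕ) (hm : 2 ≤ m) :
    modTwo (Polynomial.taylor 1 (edgeCharFactor m)) = Polynomial.X ^ (2 ^ (m - 2)) := by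
  unfold edgeCharFactor
  rw [if_neg (by omega), Polynomial.taylor_apply, modTwo_apply]
  simp only [Polynomial.add_comp, Polynomial.pow_comp, Polynomial.X_comp, Polynomial.one_comp, Polynomial.map_add,
    Polynomial.map_pow, Polynomial.map_X, Polynomial.map_one, map_one]
  rw [add_pow_char_pow, one_pow, add_assoc]
  have h11 : (1 : (ZMod 2)[X]) + 1 = 0 := by
    rw [show (1 : (ZMod 2)[X]) + 1 = Polynomial.C (1 + 1) by simp]
    have : (1 : ZMod 2) + 1 = 0 := by decide
    rw [this, map_zero]
  rw [h11, add_zero]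

/-- `Π_n(T+1) ≡ T^{q_n} (mod 2)`. -/
theorem modTwo_taylor_parityProd : ∀ n, modTwo (Polynomial.taylor 1 (parityProd n)) = Polynomial.X ^ parityDeg n ∧
    modTwo (Polynomial.taylor 1 (parityProd (n + 1))) = Polynomial.X ^ parityDeg (n + 1) := by
  intro n
  induction n with
  | zero => simp [modTwo_apply, Polynomial.taylor_one]
  | succ n ih =>
    refine ⟨ih.2, ?_⟩
    rw [show n + 1 + 1 = n + 2 from rfl, parityProd_succ_succ, parityDeg_succ_succ, Polynomial.taylor_mul, map_mul, ih.1,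
      modTwo_taylor_edgeCharFactor (n + 2) (by omega), show n + 2 - 2 = n from rfl, pow_add]

/-- **(S4λ) THE λ-SHIFT LAW (kernel-checked).**  If `2 ∣ P - Q·Π_k` in `ℤ[X]` (as (S4) provides, with `Q = S` or `B` and
`k = L - 1`), then for every `ℓ` the `ℓ`-th `T`-adic coefficient of `P` is congruent mod `2` to the `(ℓ - q_k)`-th of `Q` (`0` below `q_k`):
the mod-2 `T`-expansion of `θ_L` is that of `S` / `B` shifted by `deg ω̃_L = q_{L-1}`.  In V12's `μ = 0` encoding («`λ` = index of the
first odd `T`-coefficient») this is `λ(θ_L) = λ(S) + q_{L-1}` (`L` even) / `λ(B) + q_{L-1}` (`L` odd): `sharpFlat_lambda_shift` below. -/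
theorem taylor_coeff_mod_two_shift (P Q : ℤ[X]) (k : ℕ) (h : (2 : ℤ[X]) ∣ P - Q * parityProd k) (ℓ : ℕ) :
    (((Polynomial.taylor 1 P).coeff ℓ : ℤ) : ZMod 2) =
      (((if parityDeg k ≤ ℓ then (Polynomial.taylor 1 Q).coeff (ℓ - parityDeg k) else 0 : ℤ)) : ZMod 2) := by
  have hmod : modTwo (Polynomial.taylor 1 P) = Polynomial.taylor 1 (modTwo Q) * Polynomial.X ^ parityDeg k := by
    rw [modTwo_taylor, modTwo_eq_of_two_dvd h, map_mul, Polynomial.taylor_mul, ← modTwo_taylor, ← modTwo_taylor,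
      (modTwo_taylor_parityProd k).1, modTwo_taylor]
  have hc := congr_arg (fun f => Polynomial.coeff f ℓ) hmod
  simp only [modTwo_apply, Polynomial.coeff_map, Polynomial.coeff_mul_X_pow'] at hc
  rw [← modTwo_apply, ← modTwo_taylor, modTwo_apply, Polynomial.coeff_map] at hc
  simp only [eq_intCast] at hc
  rw [hc]
  split_ifs <;> simp

/-- `μ = 0 ∧ λ = l` in V12's elementary encoding: the `T`-coefficients below `l` are even and the `l`-th is odd. -/
def HasLambda (P : ℤ[X]) (l : ℕ) : Prop :=
  (∀ ℓ' < l, Even ((Polynomial.taylor 1 P).coeff ℓ')) ∧ Odd ((Polynomial.taylor 1 P).coeff l)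

theorem even_iff_cast_zmod_two (z : ℤ) : Even z ↔ ((z : ℤ) : ZMod 2) = 0 := by
  rw [even_iff_two_dvd]
  have h := ZMod.intCast_zmod_eq_zero_iff_dvd z 2
  push_cast at h
  exact h.symm

/-- **(S4λ) λ-SHIFT (kernel-checked):** under `2 ∣ P - Q·Π_k`, `λ(P) = λ(Q) + q_k` (in the `μ = 0` encoding, either side defined iff
the other is).  With (S4): `λ(θ_L) = λ♯ + deg ω̃_L` for `L` even, `λ(θ_L) = λ♭ + deg ω̃_L` for `L` odd — the law observed 148/148. -/
theorem lambda_shift (P Q : ℤ[X]) (k : ℕ) (h : (2 : ℤ[X]) ∣ P - Q * parityProd k) (l : ℕ) :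
    HasLambda Q l ↔ HasLambda P (l + parityDeg k) := by
  have key := taylor_coeff_mod_two_shift P Q k h
  have hodd : ∀ z : ℤ, Odd z ↔ ¬ ((z : ℤ) : ZMod 2) = 0 := fun z => by
    rw [← even_iff_cast_zmod_two, Int.not_even_iff_odd]
  simp only [HasLambda, even_iff_cast_zmod_two, hodd]
  constructor
  · rintro ⟨hlow, htop⟩
    refine ⟨fun ℓ' hℓ' => ?_, ?_⟩
    · rw [key ℓ']
      split_ifs with hq
      · exact hlow _ (by omega)
      · simp
    · rw [key, if_pos (by omega), show l + parityDeg k - parityDeg k = l by omega]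
      exact htop
  · rintro ⟨hlow, htop⟩
    refine ⟨fun ℓ' hℓ' => ?_, ?_⟩
    · have := hlow (ℓ' + parityDeg k) (by omega)
      rwa [key, if_pos (by omega), show ℓ' + parityDeg k - parityDeg k = ℓ' by omega] at this
    · have := htop
      rwa [key, if_pos (by omega), show l + parityDeg k - parityDeg k = l by omega] at this

/-- **(S4) + (S4λ) assembled:** for `a` even and a ♯/♭ pair at level `n ≥ 2`, `λ(θ_n) = λ(S_n) + q_{n-1}` if `n` is even and
`λ(θ_n) = λ(B_n) + q_{n-1}` if `n` is odd; and at level `n+1`: `λ(θ_{n+1}) = λ(B_n) + q_n` (`n` even) / `λ(S_n) + q_n` (`n` odd). -/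
theorem sharpFlat_lambda_shift (a : ℤ) (ha : (2 : ℤ) ∣ a) (n : ℕ) (hn : 2 ≤ n) (P' P S B : ℤ[X])
    (h : IsSharpFlatPair a n P' P S B) (l : ℕ) :
    (Even n → (HasLambda S l ↔ HasLambda P (l + parityDeg (n - 1))) ∧ (HasLambda B l ↔ HasLambda P' (l + parityDeg n))) ∧
    (Odd n → (HasLambda B l ↔ HasLambda P (l + parityDeg (n - 1))) ∧ (HasLambda S l ↔ HasLambda P' (l + parityDeg n))) := by
  have h4 := sharpFlat_mod_two a ha n hn P' P S B h
  constructor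
  · intro hev
    exact ⟨lambda_shift P S (n - 1) (h4.1 hev).1 l, lambda_shift P' B n (h4.1 hev).2 l⟩
  · intro hod
    exact ⟨lambda_shift P B (n - 1) (h4.2 hod).1 l, lambda_shift P' S n (h4.2 hod).2 l⟩

/-! ### (S5) THE λ-SIGNATURE FROM THE LEVEL FUNCTIONAL EQUATIONS (kernel-checked, -an g34 v5; MEMO-an §38, (R12) = P-an-37λ)

For `a` even the colours `S_n` (seen at even levels) and `B_n` (odd levels) have `λ(θ_L) = λ(S/B) + q_{L-1}` ((S4λ)); a level-`L` functional
equation `θ_L ≡ w X^{c_L} ιθ_L` with `w` odd gives `λ(θ_L) ≡ c_L (mod 2)` by the characteristic-2 second-coefficient mechanism OF THE TREE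
(`SignedLambdaParityTwoMazurTate.even_add_natTrailingDegree_of_dvd_charTwo`: at `p = 2` the Mazur–Tate comparison at `T^λ` is empty and the
`T^{λ+1}` coefficient carries `c + λ ≡ 0`); since `q_{L-1}` is even for `L` even and odd for `L` odd (`odd_parityDeg_iff`), ODD exponents at two
consecutive levels force `λ♯` odd and `λ♭` even.  CYCLOTOMIC TWIN (tree, not restated): there `c ≡ -s_N`, `η·5^{s_N} = N`, `(−1)^{s_N} = χ₈(N)`
(`neg_one_pow_val_eq_chi8`), whence `Even λ(L♯₂) ↔ N ≡ ±1 (8)` (`even_lam_sharp_two_iff`) — the edge exponent is odd for EVERY `N` instead. -/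

/-- `q_{j+2} ≡ j + 1` and `q_{j+3} ≡ j (mod 2)`: `q_2, q_3, q_4, … = 1, 2, 5, 10, 21, 42, …` alternate odd/even. -/
theorem parityDeg_mod_two (j : ℕ) : parityDeg (j + 2) % 2 = (j + 1) % 2 ∧ parityDeg (j + 3) % 2 = j % 2 := by
  induction j with
  | zero => decide
  | succ j ih =>
    obtain ⟨h1, h2⟩ := ih
    refine ⟨by rw [show j + 1 + 2 = j + 3 from rfl]; omega, ?_⟩
    rw [show j + 1 + 3 = (j + 2) + 2 from rfl, parityDeg_succ_succ]
    have hp : 2 ^ (j + 2) % 2 = 0 := by rw [pow_succ]; omega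
    omega

/-- `Odd q_k ↔ Even k` for `k ≥ 2`. -/
theorem odd_parityDeg_iff {k : ℕ} (hk : 2 ≤ k) : Odd (parityDeg k) ↔ Even k := by
  obtain ⟨j, rfl⟩ : ∃ j, k = j + 2 := ⟨k - 2, by omega⟩
  have h := (parityDeg_mod_two j).1
  rw [Nat.odd_iff, Nat.even_iff]; omega

/-- In the `μ = 0` encoding, `HasLambda P l` says: `P(T+1) mod 2` is non-zero with `T`-order exactly `l`. -/
theorem hasLambda_natTrailingDegree {P : ℤ[X]} {l : ℕ} (h : HasLambda P l) :
    modTwo (Polynomial.taylor 1 P) ≠ 0 ∧ (modTwo (Polynomial.taylor 1 P)).natTrailingDegree = l := by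
  have hc : ∀ i, (modTwo (Polynomial.taylor 1 P)).coeff i = (((Polynomial.taylor 1 P).coeff i : ℤ) : ZMod 2) := by
    intro i; rw [modTwo_apply, Polynomial.coeff_map, eq_intCast]
  have hl : (modTwo (Polynomial.taylor 1 P)).coeff l ≠ 0 := by
    rw [hc, Ne, ← even_iff_cast_zmod_two, Int.not_even_iff_odd]; exact h.2
  have hlow : ∀ i < l, (modTwo (Polynomial.taylor 1 P)).coeff i = 0 := fun i hi => by
    rw [hc]; exact (even_iff_cast_zmod_two _).mp (h.1 i hi)
  have hne : modTwo (Polynomial.taylor 1 P) ≠ 0 := fun h0 => hl (by rw [h0, Polynomial.coeff_zero])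
  refine ⟨hne, le_antisymm (Polynomial.natTrailingDegree_le_of_ne_zero hl) ?_⟩
  exact Polynomial.le_natTrailingDegree hne hlow

/-- **Level-`n` functional equation shape** `θ ≡ w·X^c·ιθ (mod ω_n)` in `ℤ[X]/(X^{2^{n-1}} - 1)`, `ι : X ↦ X⁻¹ = X^{2^{n-1}-1}`
(`Polynomial.expand`: `(ιθ)(X) = θ(X^{2^{n-1}-1})`); equivalently `ιθ ≡ w·X^{-c}·θ`, so `c ≡ -s_n`, same parity as the shift `s_n` of FE37 §1. -/
def IsLevelFE (n : ℕ) (P : ℤ[X]) (w : ℤ) (c : ℕ) : Prop :=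
  (Polynomial.X ^ (2 ^ (n - 1)) - 1 : ℤ[X]) ∣
    P - Polynomial.C w * Polynomial.X ^ c * Polynomial.expand ℤ (2 ^ (n - 1) - 1) P

open Polynomial in
/-- **THE MOD-2 FIXED-POINT STEP, imported from the tree** (`even_add_natTrailingDegree_of_dvd_charTwo`, the characteristic-2
second-coefficient mechanism of `SignedLambdaParityTwoMazurTate` §1): a level-`n` functional equation with odd scalar `w` and exponent `c`
forces `c + λ ≡ 0 (mod 2)` as soon as `n ≥ 3` and `λ + 2 ≤ 2^{n-1}` (`μ = 0` encoding). -/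
theorem even_add_lambda_of_levelFE {n : ℕ} (hn : 3 ≤ n) {P : ℤ[X]} {w : ℤ} (hw : Odd w) {c l : ℕ}
    (hFE : IsLevelFE n P w c) (hP : HasLambda P l) (hl : l + 2 ≤ 2 ^ (n - 1)) : Even (c + l) := by
  obtain ⟨hne, hdeg⟩ := hasLambda_natTrailingDegree hP
  set m : ℕ := 2 ^ (n - 1) with hm
  have h4 : 4 ∣ m := by
    obtain ⟨j, hj⟩ : ∃ j, n - 1 = j + 2 := ⟨n - 3, by omega⟩
    rw [hm, hj, pow_add]
    exact dvd_mul_of_dvd_right (by norm_num) _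
  have h1m : 1 ≤ m := Nat.one_le_two_pow
  -- Taylor shift as composition with `X + 1`
  have ht : ∀ f : ℤ[X], taylor 1 f = f.comp (X + 1) := fun f => by rw [taylor_apply, map_one]
  set θ := modTwo (taylor 1 P) with hθ
  have hθ' : θ = (P.map (Int.castRingHom (ZMod 2))).comp (X + 1) := by
    rw [hθ, ht, modTwo_apply, map_comp]; simp
  -- the odd scalar is `1` mod `2`
  have hw1 : ((w : ℤ) : ZMod 2) = 1 := by
    obtain ⟨k, rfl⟩ := hw
    push_cast
    rw [show (2 : ZMod 2) = 0 from rfl, zero_mul, zero_add]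
  -- `(X^m - 1)(X+1) ↦ X^m` in characteristic 2 (Frobenius)
  have hfrob : modTwo ((X ^ m - 1 : ℤ[X]).comp (X + 1)) = X ^ m := by
    rw [sub_comp, X_pow_comp, one_comp, map_sub, map_pow, map_add, modTwo_apply, modTwo_apply, map_X, Polynomial.map_one,
      hm, add_pow_char_pow, one_pow, add_sub_cancel_right]
  have hexp : modTwo ((expand ℤ (m - 1) P).comp (X + 1)) = θ.comp ((X + 1) ^ (m - 1) - 1) := by
    rw [expand_eq_comp_X_pow, comp_assoc, X_pow_comp, modTwo_apply, map_comp, hθ', comp_assoc, add_comp, X_comp, one_comp,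
      sub_add_cancel]
    simp
  have hCw : modTwo (C w) = 1 := by rw [modTwo_apply, map_C, eq_intCast, hw1]; exact map_one C
  have hXc : modTwo ((X + 1 : ℤ[X]) ^ c) = (X + 1) ^ c := by
    rw [map_pow, map_add, modTwo_apply, modTwo_apply, map_X, Polynomial.map_one]
  -- reduce the functional equation mod 2 and shift
  obtain ⟨Q, hQ⟩ := hFE
  rw [← hm] at hQ
  have eq1 : modTwo ((P - C w * X ^ c * expand ℤ (m - 1) P).comp (X + 1)) = θ - (X + 1) ^ c * θ.comp ((X + 1) ^ (m - 1) - 1) := by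
    rw [sub_comp, mul_comp, mul_comp, C_comp, X_pow_comp, map_sub, map_mul, map_mul, hCw, hXc, one_mul, hexp, ← ht, ← hθ]
  have eq2 : modTwo (((X ^ m - 1) * Q).comp (X + 1)) = X ^ m * modTwo (Q.comp (X + 1)) := by
    rw [mul_comp, map_mul, hfrob]
  have key := congr_arg (fun f : ℤ[X] => modTwo (f.comp (X + 1))) hQ
  rw [eq1, eq2] at key
  have hdvd : X ^ m ∣ θ - (X + 1) ^ c * θ.comp ((X + 1) ^ (m - 1) - 1) := ⟨_, key⟩
  have := Summit.BirchSwinnertonDyer.Rank1Residual.Supersingular.even_add_natTrailingDegree_of_dvd_charTwo hne h4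
    (by rw [hdeg]; exact hl) hdvd
  rwa [hdeg] at this

/-- **(S5) THE λ-SIGNATURE FROM THE LEVEL FUNCTIONAL EQUATIONS (kernel form of MEMO-an (R12) = P-an-37λ).**  `a` even, `n ≥ 3`,
`(S, B)` the level-`n` ♯/♭ pair of `(P', P) = (P_{n+1}, P_n)`, both levels satisfying a functional equation `θ ≡ w X^c ιθ` with `w` odd
and `c` ODD (the edge datum: FE37 §1, `s_n` odd on 447/447 level rows), `λ(S) = l₁`, `λ(B) = l₂` in the `μ = 0` encoding and inside the
stabilisation range (`l + q + 2 ≤` the group order at the level that carries the colour).  THEN `λ♯ = l₁` IS ODD AND `λ♭ = l₂` IS EVEN —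
for every trace `a ∈ 2ℤ`, independent of rank and root number.  Proof: (S4λ) `sharpFlat_lambda_shift` moves `λ(S), λ(B)` to
`λ(P_n), λ(P_{n+1})` shifted by `q_{n-1}, q_n` (of opposite parities, `odd_parityDeg_iff`), and the tree's characteristic-2 second-coefficient
mechanism (`even_add_lambda_of_levelFE`) gives `λ(P_level) ≡ c_level ≡ 1 (mod 2)` at both levels. -/
theorem edgeLambdaSignature (a : ℤ) (ha : (2 : ℤ) ∣ a) (n : ℕ) (hn : 3 ≤ n) (P' P S B : ℤ[X])
    (hpair : IsSharpFlatPair a n P' P S B) {w w' : ℤ} (hw : Odd w) (hw' : Odd w') {c c' : ℕ} (hc : Odd c) (hc' : Odd c')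
    (hFE : IsLevelFE n P w c) (hFE' : IsLevelFE (n + 1) P' w' c') {l₁ l₂ : ℕ} (hS : HasLambda S l₁) (hB : HasLambda B l₂)
    (h₁ : l₁ + parityDeg (n - 1) + 2 ≤ 2 ^ (n - 1)) (h₁' : l₁ + parityDeg n + 2 ≤ 2 ^ n)
    (h₂ : l₂ + parityDeg (n - 1) + 2 ≤ 2 ^ (n - 1)) (h₂' : l₂ + parityDeg n + 2 ≤ 2 ^ n) :
    Odd l₁ ∧ Even l₂ := by
  obtain ⟨j, rfl⟩ : ∃ j, n = j + 3 := ⟨n - 3, by omega⟩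
  have hq1 : parityDeg (j + 3 - 1) % 2 = (j + 1) % 2 := (parityDeg_mod_two j).1
  have hq2 : parityDeg (j + 3) % 2 = j % 2 := (parityDeg_mod_two j).2
  have hpow : 2 ^ (j + 3 + 1 - 1) = 2 ^ (j + 3) := rfl
  rcases Nat.even_or_odd (j + 3) with hev | hod
  · have hP : HasLambda P (l₁ + parityDeg (j + 3 - 1)) :=
      ((sharpFlat_lambda_shift a ha (j + 3) (by omega) P' P S B hpair l₁).1 hev).1.mp hS
    have hP' : HasLambda P' (l₂ + parityDeg (j + 3)) :=
      ((sharpFlat_lambda_shift a ha (j + 3) (by omega) P' P S B hpair l₂).1 hev).2.mp hB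
    have e1 := even_add_lambda_of_levelFE (le_refl _ |>.trans hn) hw hFE hP (by omega)
    have e2 := even_add_lambda_of_levelFE (by omega : 3 ≤ j + 3 + 1) hw' hFE' hP' (by rw [hpow]; omega)
    rw [Nat.even_iff] at e1 e2 hev
    rw [Nat.odd_iff] at hc hc'
    rw [Nat.odd_iff, Nat.even_iff]
    omega
  · have hP : HasLambda P (l₂ + parityDeg (j + 3 - 1)) :=
      ((sharpFlat_lambda_shift a ha (j + 3) (by omega) P' P S B hpair l₂).2 hod).1.mp hB
    have hP' : HasLambda P' (l₁ + parityDeg (j + 3)) :=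
      ((sharpFlat_lambda_shift a ha (j + 3) (by omega) P' P S B hpair l₁).2 hod).2.mp hS
    have e1 := even_add_lambda_of_levelFE (le_refl _ |>.trans hn) hw hFE hP (by omega)
    have e2 := even_add_lambda_of_levelFE (by omega : 3 ≤ j + 3 + 1) hw' hFE' hP' (by rw [hpow]; omega)
    rw [Nat.even_iff] at e1 e2
    rw [Nat.odd_iff] at hc hc' hod
    rw [Nat.odd_iff, Nat.even_iff]
    omega

/-- **REFUTED AS TYPED (v6, 2026-08-30; referee desk 1 §357–§358, replay `fe39chk.py` 832/832): missing binder `2 ∣ a₂`.**  For the 28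
`a₂`-ODD archive curves with `N ≡ 7 (8)` the exponent is EVEN at every level (172/172 rows), so the `∀ W` below is false; the true law is
`(−1)^c = χ₈(N)` (`EdgeFEExponentChi8`), and with `2 ∣ a₂` (which forces `N ≡ 3 (8)`, `PrimeConductorEvenTraceModEight`) the odd exponent survives as
`EdgeFEOddExponentOfEven`.  Kept verbatim as a negative edge.  ORIGINAL TEXT (v5):
**TYPED CANDIDATE (P-an-38fe) `EdgeFEOddExponent` — THE EDGE FUNCTIONAL EQUATION HAS AN ODD EXPONENT AT EVERY LEVEL.**  Setting of
(S1): `W` of prime conductor `N ≡ 3 (4)`, `k = ℚ(i)`, Gross point, nested chain `J` of edge CM ideals, `P_n = edgeThetaPoly … n (J n)`.  For every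
`n ≥ 2` there are `w ∈ ℤ` odd (in fact `w = ±1`) and `c` ODD with `P_n ≡ w·X^c·ιP_n (mod X^{2^{n-1}} - 1)`.  DATA = BC5 WITNESS (FE37-edge-matrix-FE.md
v12 §1, fe37*.py on the g28 T58 archive): `ιθ_n = w X^{s_n} θ_n` holds with `w = ±1` and `s_n` ODD on 447/447 level rows `2 ≤ n ≤ 10` of the 74
`a₂`-even archive curves (and on the `a₂`-odd ones); `c ≡ -s_n ≡ 1 (mod 2)`.  WHY IT MIGHT FAIL: the exponent is the class in `G_n = Pic ℤ[2ⁿi]`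
of the element realising the involution `J ↦ J̄` on the chain (orientation at the ramified prime); a chain/curve where that class is a square
would give `c` even — none seen.  WHY IT MATTERS: with (Θ-3term) it is the ONLY non-print input of the λ-signature (R12)
(`edgeLevelLambdaSignature_of_feOdd`).  CONTRAST: cyclotomically the exponent is `-s_N`, `η·5^{s_N} = N`, of parity `[N ≡ ±3 (8)]` (tree
`neg_one_pow_val_eq_chi8`), so `λ♯₂` is even for `N ≡ ±1 (8)`; on the `ℚ(i)`-edge both residues `N ≡ 3, 7 (8)` occur and the exponent is odd
for all of them. [v6: FALSE for the `a₂`-odd `N ≡ 7 (8)` curves — see (S6); true on the 74 `a₂`-even ones, all `N ≡ 3 (8)`.]  SOURCES: Bertolini–Darmon 1996 [doi:10.1007/s002220050059] §2.5 (functional equation of anticyclotomic theta elements,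
`p` unramified); Darmon–Iovita 2008 [doi:10.1017/S1474748007000126]; FE37 §1; nothing in print at the prime `2` ramified in `k`. -/
def EdgeFEOddExponent : Prop :=
  ∀ (W : WeierstrassCurve ℚ) [W.IsElliptic] [W.IsGloballyMinimal] (N : ℕ),
    N.Prime → N % 4 = 3 → W.conductorNorm ℤ = N →
  ∀ (k : Type) [Field k] [NumberField k], IsImaginaryQuadratic k → NumberField.discr k = -4 →
  ∀ (i₀ : k), i₀ ^ 2 = -1 → ∀ (𝔭 : Ideal (𝓞 k)), 𝔭 ^ 2 = Ideal.span {(2 : 𝓞 k)} →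
  ∀ (S : Brandt.XiSetup 1 N) [Fintype (Brandt.ClassSet S.O)] (φ : Brandt.ClassSet S.O → ℤ) (ψ : k →ₐ[ℚ] S.D)
    (I : Submodule ℤ S.D), Brandt.IsGrossPoint S.O ψ I →
    φ ≠ 0 → Brandt.eigenLattice N (Brandt.matrix S.O) (fun p => W.frobeniusTrace p) = ℤ ∙ φ →
  ∀ (J : ℕ → Submodule ℤ S.D), (∀ m ≥ 1, IsEdgeCMIdeal S.O ψ I 𝔭 m (J m)) → (∀ m ≥ 1, J (m + 1) ≤ J m) →
  ∀ n ≥ 2, ∃ (w : ℤ) (c : ℕ), Odd w ∧ Odd c ∧ IsLevelFE n (edgeThetaPoly S.O φ ψ i₀ n (J n)) w c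

/-- **(R12) AT THE LEVELS, AS A PROPOSITION: `EdgeLevelLambdaSignature`.**  Same setting, `a₂(W)` even: for every `n ≥ 3` and every ♯/♭ pair
`(S_n, B_n)` of `(P_{n+1}, P_n)` with `λ(S_n) = l₁`, `λ(B_n) = l₂` (`μ = 0` encoding) in the stabilisation range, `l₁` is ODD and `l₂` is EVEN.
DATA (MEMO-an (R12), fe37lam.py): 230/230 `μ = 0` level rows of the 38 `a₂ = ±2` archive curves, top-level `(λ♯, λ♭) ∈ {(1,2)×7, (1,6), (3,0)×15,
(3,2)×3, (3,6), (3,8), (3,10), (3,14), (5,0)×4, (5,2), (7,0), (11,0), (11,2)}`; `a₂ = 0`: the signed pair of AN-47 (same parities). -/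
def EdgeLevelLambdaSignature : Prop :=
  ∀ (W : WeierstrassCurve ℚ) [W.IsElliptic] [W.IsGloballyMinimal] (N : ℕ),
    N.Prime → N % 4 = 3 → W.conductorNorm ℤ = N → (2 : ℤ) ∣ W.frobeniusTrace 2 →
  ∀ (k : Type) [Field k] [NumberField k], IsImaginaryQuadratic k → NumberField.discr k = -4 →
  ∀ (i₀ : k), i₀ ^ 2 = -1 → ∀ (𝔭 : Ideal (𝓞 k)), 𝔭 ^ 2 = Ideal.span {(2 : 𝓞 k)} →
  ∀ (S : Brandt.XiSetup 1 N) [Fintype (Brandt.ClassSet S.O)] (φ : Brandt.ClassSet S.O → ℤ) (ψ : k →ₐ[ℚ] S.D)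
    (I : Submodule ℤ S.D), Brandt.IsGrossPoint S.O ψ I →
    φ ≠ 0 → Brandt.eigenLattice N (Brandt.matrix S.O) (fun p => W.frobeniusTrace p) = ℤ ∙ φ →
  ∀ (J : ℕ → Submodule ℤ S.D), (∀ m ≥ 1, IsEdgeCMIdeal S.O ψ I 𝔭 m (J m)) → (∀ m ≥ 1, J (m + 1) ≤ J m) →
  ∀ n ≥ 3, ∀ (Sn Bn : ℤ[X]) (l₁ l₂ : ℕ),
    IsSharpFlatPair (W.frobeniusTrace 2) n (edgeThetaPoly S.O φ ψ i₀ (n + 1) (J (n + 1))) (edgeThetaPoly S.O φ ψ i₀ n (J n)) Sn Bn →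
    HasLambda Sn l₁ → HasLambda Bn l₂ →
    l₁ + parityDeg (n - 1) + 2 ≤ 2 ^ (n - 1) → l₁ + parityDeg n + 2 ≤ 2 ^ n →
    l₂ + parityDeg (n - 1) + 2 ≤ 2 ^ (n - 1) → l₂ + parityDeg n + 2 ≤ 2 ^ n →
    Odd l₁ ∧ Even l₂

/-- **KERNEL REDUCTION «(R12) ⟸ (FE-odd)»:** the edge λ-signature at the levels follows from `EdgeFEOddExponent` (given the ♯/♭ pair, i.e.
(Θ-3term) via `sharpFlatPair_of_threeTerm`). -/
theorem edgeLevelLambdaSignature_of_feOdd (hFE : EdgeFEOddExponent) : EdgeLevelLambdaSignature := by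
  intro W _ _ N hN hN4 hcond ha k _ _ hk hdisc i₀ hi₀ 𝔭 h𝔭 S _ φ ψ I hGross hφ heig J hJ hnest n hn Sn Bn l₁ l₂ hpair hS hB h₁ h₁' h₂ h₂'
  obtain ⟨w, c, hw, hc, hfe⟩ := hFE W N hN hN4 hcond k hk hdisc i₀ hi₀ 𝔭 h𝔭 S φ ψ I hGross hφ heig J hJ hnest n (by omega)
  obtain ⟨w', c', hw', hc', hfe'⟩ := hFE W N hN hN4 hcond k hk hdisc i₀ hi₀ 𝔭 h𝔭 S φ ψ I hGross hφ heig J hJ hnest (n + 1) (by omega)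
  exact edgeLambdaSignature (W.frobeniusTrace 2) ha n hn _ _ Sn Bn hpair hw hw' hc hc' hfe hfe' hS hB h₁ h₁' h₂ h₂'

/-! ### (S6) v6 REPAIR OF (P-an-38fe): the χ₈-law of the edge exponent, Serre's constraint `N ≡ ±3 (8)`, and `EdgeFEOddExponentOfEven` -/

/-- **(P-an-39χ) `EdgeFEExponentChi8` — THE SIGN OF THE EDGE FUNCTIONAL EQUATION IS `χ₈(N)`.**  Setting of (S1) (prime `N ≡ 3 (4)`, `k = ℚ(i)`,
Gross point, nested edge chain), ANY `a₂`: for every `n ≥ 2` the level functional equation `P_n ≡ w·X^c·ιP_n` holds with `w` odd and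
`(−1)^c = χ₈(N)`, i.e. `c` odd ↔ `N ≡ 3 (8)` (for `N ≡ 3 (4)` prime, `N mod 8 ∈ {3, 7}`; typed verbatim as referee desk 1's C′₂, §358).  DATA = BC5 WITNESS: 832/832 single-parity level rows
(`2 ≤ n ≤ 10`) of the 127 T58 archive curves (`(a₂ mod 2, N mod 8) = (0,3)×74, (1,7)×28, (1,3)×25`) obey `(−1)^{s_n} = χ₈(N)` (`c ≡ −s_n`), referee
desk 1 law L358.1 and `fe39chk.py` (two engines).  WHY IT MIGHT FAIL: the exponent is the class realising `J ↦ J̄` in `Pic ℤ[2ⁿ i]`; the claim is that its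
parity is the quadratic character of `(2)` in `ℚ(√−N)`… a chain with a different orientation at the ramified prime could shift `c` by one — none seen.
CYCLOTOMIC TWIN (tree): `(−1)^{s_N} = χ₈(N)` (`neg_one_pow_val_eq_chi8`).  SOURCES: Bertolini–Darmon 1996 [doi:10.1007/s002220050059] §2.5;
FE37 §1; REF1 §358; nothing in print at the prime `2` ramified in `k`. -/
def EdgeFEExponentChi8 : Prop :=
  ∀ (W : WeierstrassCurve ℚ) [W.IsElliptic] [W.IsGloballyMinimal] (N : ℕ),
    N.Prime → N % 4 = 3 → W.conductorNorm ℤ = N →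
  ∀ (k : Type) [Field k] [NumberField k], IsImaginaryQuadratic k → NumberField.discr k = -4 →
  ∀ (i₀ : k), i₀ ^ 2 = -1 → ∀ (𝔭 : Ideal (𝓞 k)), 𝔭 ^ 2 = Ideal.span {(2 : 𝓞 k)} →
  ∀ (S : Brandt.XiSetup 1 N) [Fintype (Brandt.ClassSet S.O)] (φ : Brandt.ClassSet S.O → ℤ) (ψ : k →ₐ[ℚ] S.D)
    (I : Submodule ℤ S.D), Brandt.IsGrossPoint S.O ψ I →
    φ ≠ 0 → Brandt.eigenLattice N (Brandt.matrix S.O) (fun p => W.frobeniusTrace p) = ℤ ∙ φ →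
  ∀ (J : ℕ → Submodule ℤ S.D), (∀ m ≥ 1, IsEdgeCMIdeal S.O ψ I 𝔭 m (J m)) → (∀ m ≥ 1, J (m + 1) ≤ J m) →
  ∀ n ≥ 2, ∃ (w : ℤ) (c : ℕ), Odd w ∧ (Odd c ↔ N % 8 = 3) ∧ IsLevelFE n (edgeThetaPoly S.O φ ψ i₀ n (J n)) w c

/-- **(P-an-39s) `PrimeConductorEvenTraceModEight` — PRIME CONDUCTOR AND SUPERSINGULAR AT `2` FORCE `χ₈(N) = −1`.**  `E/ℚ` of odd prime conductor
`N` with `2 ∣ a₂(E)` (good supersingular reduction at `2`) has `N ≡ ±3 (mod 8)`.  PROOF SKETCH (Serre 1972, «Propriétés galoisiennes…» §1.11, §5):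
the formal group at `2` has height `2`, so tame inertia acts on `E[2]` through the fundamental character of level `2` (order `3`) and `Frob₂` conjugates
it to its square: the decomposition group at `2` surjects onto `Aut E[2] ≅ S₃`, hence is not contained in `A₃`, i.e. `Frob₂` is non-trivial on
`ℚ(√Δ_E)`; prime conductor gives `Δ_E = ±N^δ`, the field `ℚ(√Δ_E)` is quadratic, unramified at `2`, so `= ℚ(√N*)` (`N* = χ₄(N)·N ≡ 1 (4)`) with `2`
INERT: `N* ≡ 5 (8)`, i.e. `N ≡ ±3 (8)`.  DATA = BC5 WITNESS: 74/74 `a₂`-even T58 archive curves (`N ≡ 3 (8)`), 83/83 prime-conductor supersingular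
D9 curves `N < 12 000` (`N ≡ 5 (8)`); 0 prime-conductor supersingular curves with `N ≡ ±1 (8)` in either table.  WHY IT MIGHT FAIL: only through a
mis-typing (e.g. `frobeniusTrace` junk at bad `2`, excluded by `N` odd); the mathematics is Serre's.  [Serre 1972, Invent. Math. 15, Prop. 12 + §5.4] -/
def PrimeConductorEvenTraceModEight : Prop :=
  ∀ (W : WeierstrassCurve ℚ) [W.IsElliptic] [W.IsGloballyMinimal] (N : ℕ),
    N.Prime → N % 2 = 1 → W.conductorNorm ℤ = N → (2 : ℤ) ∣ W.frobeniusTrace 2 → N % 8 = 3 ∨ N % 8 = 5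

/-- **REPAIRED CANDIDATE (P-an-38fe′) `EdgeFEOddExponentOfEven`** = `EdgeFEOddExponent` WITH the binder `2 ∣ a₂(W)` (good supersingular at `2`,
`a₂ ∈ {0, ±2}`): odd scalar, ODD exponent at every level `n ≥ 2`.  DATA: 447/447 level rows of the 74 `a₂`-even archive curves (all `N ≡ 3 (8)`).
It follows from the two statements above (`edgeFEOddExponentOfEven_of_chi8`), and it is exactly what (R12) consumes (`edgeLevelLambdaSignature_of_feOddOfEven`). -/
def EdgeFEOddExponentOfEven : Prop :=
  ∀ (W : WeierstrassCurve ℚ) [W.IsElliptic] [W.IsGloballyMinimal] (N : ℕ),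
    N.Prime → N % 4 = 3 → W.conductorNorm ℤ = N → (2 : ℤ) ∣ W.frobeniusTrace 2 →
  ∀ (k : Type) [Field k] [NumberField k], IsImaginaryQuadratic k → NumberField.discr k = -4 →
  ∀ (i₀ : k), i₀ ^ 2 = -1 → ∀ (𝔭 : Ideal (𝓞 k)), 𝔭 ^ 2 = Ideal.span {(2 : 𝓞 k)} →
  ∀ (S : Brandt.XiSetup 1 N) [Fintype (Brandt.ClassSet S.O)] (φ : Brandt.ClassSet S.O → ℤ) (ψ : k →ₐ[ℚ] S.D)
    (I : Submodule ℤ S.D), Brandt.IsGrossPoint S.O ψ I →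
    φ ≠ 0 → Brandt.eigenLattice N (Brandt.matrix S.O) (fun p => W.frobeniusTrace p) = ℤ ∙ φ →
  ∀ (J : ℕ → Submodule ℤ S.D), (∀ m ≥ 1, IsEdgeCMIdeal S.O ψ I 𝔭 m (J m)) → (∀ m ≥ 1, J (m + 1) ≤ J m) →
  ∀ n ≥ 2, ∃ (w : ℤ) (c : ℕ), Odd w ∧ Odd c ∧ IsLevelFE n (edgeThetaPoly S.O φ ψ i₀ n (J n)) w c

/-- **KERNEL REDUCTION «(FE-odd, supersingular) ⟸ χ₈-law + Serre».** -/
theorem edgeFEOddExponentOfEven_of_chi8 (h8 : PrimeConductorEvenTraceModEight) (hχ : EdgeFEExponentChi8) :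
    EdgeFEOddExponentOfEven := by
  intro W _ _ N hN hN4 hcond ha k _ _ hk hdisc i₀ hi₀ 𝔭 h𝔭 S _ φ ψ I hGross hφ heig J hJ hnest n hn
  obtain ⟨w, c, hw, hc, hfe⟩ := hχ W N hN hN4 hcond k hk hdisc i₀ hi₀ 𝔭 h𝔭 S φ ψ I hGross hφ heig J hJ hnest n hn
  have h35 := h8 W N hN (by omega) hcond ha
  exact ⟨w, c, hw, hc.mpr (by omega), hfe⟩

/-- **KERNEL REDUCTION «(R12) ⟸ (FE-odd, supersingular)»** (v6 re-basing of `edgeLevelLambdaSignature_of_feOdd`). -/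
theorem edgeLevelLambdaSignature_of_feOddOfEven (hFE : EdgeFEOddExponentOfEven) : EdgeLevelLambdaSignature := by
  intro W _ _ N hN hN4 hcond ha k _ _ hk hdisc i₀ hi₀ 𝔭 h𝔭 S _ φ ψ I hGross hφ heig J hJ hnest n hn Sn Bn l₁ l₂ hpair hS hB h₁ h₁' h₂ h₂'
  obtain ⟨w, c, hw, hc, hfe⟩ := hFE W N hN hN4 hcond ha k hk hdisc i₀ hi₀ 𝔭 h𝔭 S φ ψ I hGross hφ heig J hJ hnest n (by omega)
  obtain ⟨w', c', hw', hc', hfe'⟩ := hFE W N hN hN4 hcond ha k hk hdisc i₀ hi₀ 𝔭 h𝔭 S φ ψ I hGross hφ heig J hJ hnest (n + 1) (by omega)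
  exact edgeLambdaSignature (W.frobeniusTrace 2) ha n hn _ _ Sn Bn hpair hw hw' hc hc' hfe hfe' hS hB h₁ h₁' h₂ h₂'

/-- **(R12) ⟸ (Θ-3term) + χ₈-law + Serre** — the v6 dependency statement of the edge λ-signature. -/
theorem edgeLevelLambdaSignature_of_chi8 (h8 : PrimeConductorEvenTraceModEight) (hχ : EdgeFEExponentChi8) :
    EdgeLevelLambdaSignature :=
  edgeLevelLambdaSignature_of_feOddOfEven (edgeFEOddExponentOfEven_of_chi8 h8 hχ)

end Summit.BirchSwinnertonDyer.BirchSwinnertonDyer.Cruxes.RankOneAtTwoBigImageOddLocal.SharpFlat
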